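import Summits.Parity.BatemanHorn.Theses.IsogenyRedei
import Literature.NumberTheory.EllipticCurves.RootNumberLocalConstancy
import Literature.NumberTheory.EllipticCurves.TwoIsogenySelmerGroup
import Literature.NumberTheory.EllipticCurves.BinaryQuarticLocalSolubility

/-!
# Disproof of `PencilSelmerDictionary` (stmt-Parity-11584, route IsogenyRedei, crux rank 3) — findings

Standing adversary file (cdisprove seat `refuter-cdisprove-stmt-Parity-11584-0`). Prose lives in
docstrings; every `theorem` below is sorry-free unless its docstring says NEAR-MISS.

The crux (verbatim, `Summit.Parity.BatemanHorn.Theses.IsogenyRedei.PencilSelmerDictionary`):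
`∃ M, ∃ w : ℕ → ℤ, (∀ t, w (t + 2^M) = w t) ∧ ∀ t ≥ 1,
   (-1)^(selmerCorank E_t 2) = -(w t * (-1)^#{odd primes p ∣ t²+1})`,  `E_t = ⟨0, 2t, 0, t²+1, 0⟩ / ℚ`.

## Index of findings

* §1 NORMAL FORM (pure logic, `abstract_iff_periodic`, `iff_periodic`): the `∃ w` is eliminable; the
  crux says exactly that the sign `s t := (-1)^(corank E_t) · (-1)^(ω_odd(t²+1))` is `2^M`-periodic on
  `t ≥ 1` for some `M` (and then `w = -s` is forced on `t ≥ 1`). (Same content as the rattack seat's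
  attached `NormalForm.lean`; re-derived here because later lemmas use it.)
* §2 LOAD-BEARING ANALYSIS: the ONLY load-bearing clause is the periodicity of `w`
  (`withoutPeriodicity_trivial`: with `w` unconstrained the statement is a tautology). The leading
  minus sign and the restriction to ODD prime factors are cosmetic (`iff_noSign`, `iff_allPrimes`:
  `2 ∣ t²+1 ↔ t odd`, a 2-periodic correction absorbed by `w`). `1 ≤ t` is harmless (t = 0 is the CM
  curve `y² = x³ + x`, consistent with the expected table, see §4).
* §2b LOAD-BEARING GEOMETRIC INPUT (`Fibres.not_two_pow_nine_dvd_Δ`, `Fibres.two_pow_eight_dvd_Δ_of_odd`,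
  `Fibres.Fint_one_singular`, `Fibres.two_pow_dvd_Δ_sister`): `v₂(Δ(E_t)) ≤ 8` on `ℤ` (no 2-adic
  singular fibre — the hypothesis under which Helfgott's Lemma 4.4 + compactness give a UNIFORM 2-adic
  period), sharp at odd `t`; the sister pencil `a₄ = t² - 1` violates it (`F_1` singular,
  `2^n ∣ Δ(F_{1+2^n})`), which is why "constant dual locus" alone is not the right hypothesis —
  "no `ℤ₂`-point of the discriminant locus" is.
* §3 WEAKENING THAT THE TREE FACTS ACTUALLY DELIVER (`AnyPeriod`, `anyPeriod_of`): with period an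
  arbitrary `N ≥ 1` instead of `2^M`. Interface remark for provers/planner (docstring of `AnyPeriod`):
  from `p_parity` + `Helfgott2004_exists_local_tables_locallyConstant` one gets
  `(-1)^corank = -w₂(E_t)·w₃(E_t)·(-1)^{ω_odd}` with `w₂` `2^M`-periodic and `w₃` `3^K`-periodic — the
  tables of that fact are tied to Rohrlich's `localRootNumber` only in residue characteristic `> 3`
  (clause (3)), so `w₃(E_t ⊗ ℚ₃) = +1` (good reduction at 3, true) is NOT available from the fact as
  stated; the `2^M` form of the crux therefore needs either a sharpened clause (3) (semistable fibres at
  every `v`) or the `AnyPeriod` restatement. Not a falsity issue.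
* §3b NON-PINNING OF `w₃`, LEAN-CERTIFIED (`Tables.helfgottClauses_flip`,
  `Tables.exists_witnesses_opposite_at_three`): the clause set of the named fact is invariant under
  negating the tables at `2` and `3` simultaneously, so with every witness it has one whose table at `3`
  takes the opposite sign on any given `ℚ₃`-curve — "`w₃ = +1` at good reduction" is NOT a consequence
  of the fact. (`anyPeriod_shape_not_imp_pow_two_shape` in §3: the any-period form is strictly
  weaker in logic, so the `2^M` form does carry the 2-adic information.)
* §4b TIGHTNESS, LEAN-CERTIFIED GRANTED CASSELS' FORMULA (`Descent.not_pencilSelmerDictionaryWith_one`,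
  `Descent.forced_w_values`, `Descent.sharp_table_holds_upto_four`): explicit `2`-isogeny descents at
  `t = 1, 2, 3, 4` (eight Selmer sets computed as `Finset`s, 2-adic obstructions by `decide` modulo
  `16`/`32`) give the Selmer-side signs `+1, -1, -1, +1`; hence the crux is FALSE with `M ≤ 1` (least
  period `≥ 4`), and any witness has `w = (-1, -1, +1, +1)` on `t mod 4 = (0,1,2,3)` — the crux
  ideator's numerical table (j004946, period 4 to `t ≤ 4000`), certified on a residue system.
* §4 SHARP FORM / EXPLICIT WITNESS (`Sharp`, `of_sharp`): packaging `w t = tab (t % 2^M)`; the numerics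
  (PARI job j004779, see §5) pin the least `M` and the table `tab = W₂(E_t)`; provers should aim at
  `Sharp M₀ wTable`.
* §5 NUMERICAL ATTACKS (PARI, job ids in the docstrings): (i) is `t ↦ W₂(E_t)` `2^M`-periodic and
  with which least `M`; (ii) the global identity `W(E_t) = -W₂(E_t)·(-1)^{ω_odd(t²+1)}` (i.e. every odd
  `p ∣ t²+1` is SPLIT multiplicative, `W_p = -1`); (iii) control experiment on the sister pencil
  `a₄ = t² - 1` (2-adically singular fibres `t = ±1`), where periodicity is expected to FAIL — showing
  that "no 2-adic singular fibre" is the load-bearing geometric input; (iv) refuted natural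
  strengthenings: `M = 0` (w constant) and the Liouville/Ω variant.
* §6 WHY IT RESISTS: theorem in print = 2-parity (Dokchitser–Dokchitser 2010 Thm 1.4 / Monsky 1996)
  ∘ product formula ∘ Rohrlich Prop. 2 at odd `p` (split: `(2t|p) = (2|p)(t|p) = +1` for `p ≡ 1 (4)`,
  `t` of order 4) ∘ Helfgott 2004 Prop. 4.2 (E_t has potentially GOOD reduction at 2 for every
  `t ∈ ℤ₂`: `v₂(j) = 6` for even `t`, `7` for odd `t`) ∘ compactness of `ℤ₂` (all fibres over `ℤ₂`
  are smooth: `Δ = -64(t²+1)²`, `v₂ ∈ {6, 8}`). No Lean refutation is possible in any case: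
  `selmerCorank` is a genuine, non-computable Galois-cohomology definition, so `¬ crux` would need the
  corank parities of infinitely many `E_t`.
-/

namespace Summit.Parity.BatemanHorn.Cruxes.PencilSelmerDictionary.Disproof

open Summit.Parity.BatemanHorn.Theses.IsogenyRedei

/-! ## §0 Notation -/

/-- The pencil `E_t : y² = x³ + 2t·x² + (t²+1)·x = x((x+t)²+1)` over `ℚ`, exactly the anonymous
constructor term of the crux. [folklore] -/
abbrev E (t : ℕ) : WeierstrassCurve ℚ := ⟨0, 2 * (t : ℚ), 0, (t : ℚ) ^ 2 + 1, 0⟩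

/-- `corank t := corank_{ℤ₂} Sel_{2^∞}(E_t/ℚ)` (the Literature definition used by the crux). -/
noncomputable abbrev corank (t : ℕ) : ℕ := WeierstrassCurve.selmerCorank (E t) 2

/-- `ω_odd(t²+1)`: the number of odd prime factors of `t²+1`, the crux's exact `Finset` term. -/
abbrev omegaOdd (t : ℕ) : ℕ := ((t ^ 2 + 1).primeFactors.filter (fun p : ℕ => p ≠ 2)).card

/-- The sign whose `2^M`-periodicity the crux asserts: `s t = (-1)^(corank E_t) · (-1)^(ω_odd(t²+1))`.
Under 2-parity and the local analysis, `s t = -W₂(E_t)·W₃(E_t) = -W₂(E_t)`. -/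
noncomputable def s (t : ℕ) : ℤ := (-1 : ℤ) ^ corank t * (-1 : ℤ) ^ omegaOdd t

/-! ## §1 Normal form (pure logic) -/

section Abstract

variable (c k : ℕ → ℕ)

theorem neg_one_pow_mul_self (n : ℕ) : ((-1 : ℤ) ^ n) * ((-1 : ℤ) ^ n) = 1 := by
  rw [← mul_pow, neg_mul_neg, one_mul, one_pow]

/-- Iterating a period. [folklore] -/
theorem periodic_iterate {α : Type*} (f : ℕ → α) (P : ℕ) (lo : ℕ)
    (h : ∀ t, lo ≤ t → f (t + P) = f t) : ∀ n t, lo ≤ t → f (t + P * n) = f t := by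
  intro n
  induction n with
  | zero => intro t _; simp
  | succ n ih =>
    intro t ht
    have : t + P * (n + 1) = (t + P * n) + P := by ring
    rw [this, h _ (le_trans ht (Nat.le_add_right _ _)), ih t ht]

/-- ABSTRACT NORMAL FORM. For arbitrary exponent functions `c k : ℕ → ℕ`:
`(∃ M w, w 2^M-periodic ∧ ∀ t ≥ 1, (-1)^(c t) = -(w t · (-1)^(k t)))  ↔
 (∃ M, ∀ t ≥ 1, (-1)^(c (t+2^M))·(-1)^(k (t+2^M)) = (-1)^(c t)·(-1)^(k t))`.
So the existential `w` carries no information beyond the periodicity of the sign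
`(-1)^(c+k)`; on `t ≥ 1` it is forced to be `w t = -(-1)^(c t + k t)`. [folklore] -/
theorem abstract_iff_periodic :
    (∃ M : ℕ, ∃ w : ℕ → ℤ, (∀ t : ℕ, w (t + 2 ^ M) = w t) ∧
        ∀ t : ℕ, 1 ≤ t → (-1 : ℤ) ^ c t = -(w t * (-1 : ℤ) ^ k t)) ↔
      ∃ M : ℕ, ∀ t : ℕ, 1 ≤ t →
        (-1 : ℤ) ^ c (t + 2 ^ M) * (-1 : ℤ) ^ k (t + 2 ^ M) = (-1 : ℤ) ^ c t * (-1 : ℤ) ^ k t := by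
  constructor
  · rintro ⟨M, w, hw, h⟩
    refine ⟨M, fun t ht => ?_⟩
    have key : ∀ u, 1 ≤ u → (-1 : ℤ) ^ c u * (-1 : ℤ) ^ k u = -w u := by
      intro u hu
      rw [h u hu, neg_mul, mul_assoc, neg_one_pow_mul_self, mul_one]
    rw [key t ht, key (t + 2 ^ M) (le_trans ht (Nat.le_add_right _ _)), hw]
  · rintro ⟨M, h⟩
    -- witness: `w t := -σ (t + 2^M)`, which is `2^M`-periodic on ALL of `ℕ` because `t + 2^M ≥ 1`
    refine ⟨M, fun t => -((-1 : ℤ) ^ c (t + 2 ^ M) * (-1 : ℤ) ^ k (t + 2 ^ M)), fun t => ?_,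
      fun t ht => ?_⟩
    · show -((-1 : ℤ) ^ c (t + 2 ^ M + 2 ^ M) * (-1 : ℤ) ^ k (t + 2 ^ M + 2 ^ M)) =
        -((-1 : ℤ) ^ c (t + 2 ^ M) * (-1 : ℤ) ^ k (t + 2 ^ M))
      rw [h (t + 2 ^ M) (le_trans NeZero.one_le (Nat.le_add_left _ _))]
    · show (-1 : ℤ) ^ c t = -(-((-1 : ℤ) ^ c (t + 2 ^ M) * (-1 : ℤ) ^ k (t + 2 ^ M)) * (-1 : ℤ) ^ k t)
      rw [h t ht, neg_mul, neg_neg, mul_assoc, neg_one_pow_mul_self, mul_one]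

/-- Without the periodicity clause the statement is a TAUTOLOGY (take `w = -(-1)^(c+k)`): any proof
of the crux must use periodicity, and nothing else in it has content. [folklore] -/
theorem abstract_withoutPeriodicity :
    ∃ w : ℕ → ℤ, ∀ t : ℕ, 1 ≤ t → (-1 : ℤ) ^ c t = -(w t * (-1 : ℤ) ^ k t) :=
  ⟨fun t => -((-1 : ℤ) ^ c t * (-1 : ℤ) ^ k t), fun t _ => by
    rw [neg_mul, neg_neg, mul_assoc, neg_one_pow_mul_self, mul_one]⟩

/-- The leading minus sign is cosmetic (`w ↦ -w`). [folklore] -/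
theorem abstract_iff_noSign :
    (∃ M : ℕ, ∃ w : ℕ → ℤ, (∀ t : ℕ, w (t + 2 ^ M) = w t) ∧
        ∀ t : ℕ, 1 ≤ t → (-1 : ℤ) ^ c t = -(w t * (-1 : ℤ) ^ k t)) ↔
      ∃ M : ℕ, ∃ w : ℕ → ℤ, (∀ t : ℕ, w (t + 2 ^ M) = w t) ∧
        ∀ t : ℕ, 1 ≤ t → (-1 : ℤ) ^ c t = w t * (-1 : ℤ) ^ k t := by
  constructor
  · rintro ⟨M, w, hw, h⟩
    exact ⟨M, fun t => -w t, fun t => by simp [hw t], fun t ht => by rw [h t ht, neg_mul]⟩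
  · rintro ⟨M, w, hw, h⟩
    exact ⟨M, fun t => -w t, fun t => by simp [hw t], fun t ht => by rw [h t ht, neg_mul, neg_neg]⟩

/-- Monotonicity in `M`: a `2^M`-periodic `w` is `2^(M+1)`-periodic. [folklore] -/
theorem periodic_succ (w : ℕ → ℤ) (M : ℕ) (hw : ∀ t : ℕ, w (t + 2 ^ M) = w t) :
    ∀ t : ℕ, w (t + 2 ^ (M + 1)) = w t := by
  intro t
  have : t + 2 ^ (M + 1) = (t + 2 ^ M) + 2 ^ M := by ring
  rw [this, hw, hw]

/-- Explicit-witness packaging: a table on residues mod `2^M` gives the crux shape. [folklore] -/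
theorem abstract_of_sharp (M : ℕ) (tab : ℕ → ℤ)
    (h : ∀ t : ℕ, 1 ≤ t → (-1 : ℤ) ^ c t = -(tab (t % 2 ^ M) * (-1 : ℤ) ^ k t)) :
    ∃ M : ℕ, ∃ w : ℕ → ℤ, (∀ t : ℕ, w (t + 2 ^ M) = w t) ∧
        ∀ t : ℕ, 1 ≤ t → (-1 : ℤ) ^ c t = -(w t * (-1 : ℤ) ^ k t) :=
  ⟨M, fun t => tab (t % 2 ^ M), fun t => by simp [Nat.add_mod_right], h⟩

end Abstract

/-- NORMAL FORM of the crux: `PencilSelmerDictionary ↔ ∃ M, ∀ t ≥ 1, s (t + 2^M) = s t` with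
`s t = (-1)^(corank E_t)·(-1)^(ω_odd(t²+1))`. [folklore] -/
theorem iff_periodic :
    PencilSelmerDictionary ↔ ∃ M : ℕ, ∀ t : ℕ, 1 ≤ t → s (t + 2 ^ M) = s t :=
  abstract_iff_periodic corank omegaOdd

/-! ## §2 Load-bearing analysis -/

/-- The crux with the periodicity clause DROPPED. -/
def WithoutPeriodicity : Prop :=
  ∃ w : ℕ → ℤ, ∀ t : ℕ, 1 ≤ t →
    (-1 : ℤ) ^ (WeierstrassCurve.selmerCorank (⟨0, 2 * (t : ℚ), 0, (t : ℚ) ^ 2 + 1, 0⟩ :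
      WeierstrassCurve ℚ) 2) =
      -(w t * (-1 : ℤ) ^ (((t ^ 2 + 1).primeFactors.filter (fun p : ℕ => p ≠ 2)).card))

/-- `WithoutPeriodicity` is a tautology: periodicity of `w` is the crux's ONLY content (the usual
`_false_without_` shape degenerates here to "trivially TRUE without", which carries the same
message: a proof must produce the period). [folklore] -/
theorem withoutPeriodicity_trivial : WithoutPeriodicity :=
  abstract_withoutPeriodicity corank omegaOdd

/-- Variant without the leading minus sign. -/
def NoSign : Prop :=
  ∃ M : ℕ, ∃ w : ℕ → ℤ, (∀ t : ℕ, w (t + 2 ^ M) = w t) ∧ ∀ t : ℕ, 1 ≤ t →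
    (-1 : ℤ) ^ (WeierstrassCurve.selmerCorank (⟨0, 2 * (t : ℚ), 0, (t : ℚ) ^ 2 + 1, 0⟩ :
      WeierstrassCurve ℚ) 2) =
      w t * (-1 : ℤ) ^ (((t ^ 2 + 1).primeFactors.filter (fun p : ℕ => p ≠ 2)).card)

/-- The sign convention is cosmetic. [folklore] -/
theorem iff_noSign : PencilSelmerDictionary ↔ NoSign :=
  abstract_iff_noSign corank omegaOdd

/-- Variant counting ALL prime factors of `t²+1` (including `2`, which divides `t²+1` iff `t` is odd). -/
def AllPrimes : Prop :=
  ∃ M : ℕ, ∃ w : ℕ → ℤ, (∀ t : ℕ, w (t + 2 ^ M) = w t) ∧ ∀ t : ℕ, 1 ≤ t →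
    (-1 : ℤ) ^ (WeierstrassCurve.selmerCorank (⟨0, 2 * (t : ℚ), 0, (t : ℚ) ^ 2 + 1, 0⟩ :
      WeierstrassCurve ℚ) 2) =
      -(w t * (-1 : ℤ) ^ (t ^ 2 + 1).primeFactors.card)

/-- `2 ∣ t² + 1 ↔ t` is odd. [folklore] -/
theorem two_dvd_sq_add_one_iff (t : ℕ) : 2 ∣ t ^ 2 + 1 ↔ ¬ Even t := by
  rw [← even_iff_two_dvd, Nat.even_add_one, Nat.even_pow' two_ne_zero]

/-- `2 ∣ t² + 1 ↔ t` odd, so `#primeFactors(t²+1) = ω_odd(t²+1) + (t % 2)`. [folklore] -/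
theorem card_primeFactors_eq (t : ℕ) :
    (t ^ 2 + 1).primeFactors.card = omegaOdd t + t % 2 := by
  unfold omegaOdd
  rw [Finset.filter_ne']
  rcases Nat.even_or_odd t with he | ho
  · -- t even: 2 ∤ t²+1
    have h2 : (2 : ℕ) ∉ (t ^ 2 + 1).primeFactors := by
      rw [Nat.mem_primeFactors]
      rintro ⟨-, hdvd, -⟩
      exact (two_dvd_sq_add_one_iff t).mp hdvd he
    rw [Finset.erase_eq_of_notMem h2, Nat.even_iff.mp he, add_zero]
  · have h2 : (2 : ℕ) ∈ (t ^ 2 + 1).primeFactors := by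
      rw [Nat.mem_primeFactors]
      exact ⟨Nat.prime_two, (two_dvd_sq_add_one_iff t).mpr (Nat.not_even_iff_odd.mpr ho), by omega⟩
    rw [← Finset.card_erase_add_one h2, Nat.odd_iff.mp ho]

/-- The restriction to ODD prime factors is cosmetic: the parity of `t` is `2`-periodic and is
absorbed by `w` (`w' t = w t · (-1)^t`, period `2^(M+1)`). [folklore] -/
theorem iff_allPrimes : PencilSelmerDictionary ↔ AllPrimes := by
  have hpm : ∀ t : ℕ, (-1 : ℤ) ^ (t % 2) = (-1 : ℤ) ^ t := fun t => by
    conv_rhs => rw [← Nat.div_add_mod t 2, pow_add, pow_mul]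
    simp
  have hper : ∀ (w : ℕ → ℤ) (M : ℕ), (∀ t : ℕ, w (t + 2 ^ M) = w t) →
      ∀ t : ℕ, w (t + 2 ^ (M + 1)) * (-1 : ℤ) ^ (t + 2 ^ (M + 1)) = w t * (-1 : ℤ) ^ t := by
    intro w M hw t
    rw [periodic_succ w M hw t, pow_add, pow_succ', pow_mul, neg_one_sq, one_pow, mul_one]
  unfold PencilSelmerDictionary AllPrimes
  constructor
  · rintro ⟨M, w, hw, h⟩
    refine ⟨M + 1, fun t => w t * (-1 : ℤ) ^ t, hper w M hw, fun t ht => ?_⟩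
    rw [h t ht, card_primeFactors_eq, pow_add, hpm]
    show -(w t * (-1 : ℤ) ^ omegaOdd t) = -(w t * (-1 : ℤ) ^ t * ((-1 : ℤ) ^ omegaOdd t * (-1 : ℤ) ^ t))
    linear_combination (w t * (-1 : ℤ) ^ omegaOdd t) * neg_one_pow_mul_self t
  · rintro ⟨M, w, hw, h⟩
    refine ⟨M + 1, fun t => w t * (-1 : ℤ) ^ t, hper w M hw, fun t ht => ?_⟩
    rw [h t ht, card_primeFactors_eq, pow_add, hpm]
    show -(w t * ((-1 : ℤ) ^ omegaOdd t * (-1 : ℤ) ^ t)) = -(w t * (-1 : ℤ) ^ t * (-1 : ℤ) ^ omegaOdd t)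
    ring


/-! ## §2b The load-bearing GEOMETRIC input: no 2-adic singular fibre

On the informal side the crux is 2-parity ∘ product formula ∘ (split fibres at odd `p`) ∘ LOCAL
CONSTANCY OF `W₂(E_t)` UNIFORMLY ON `ℤ₂`. The last step (Helfgott 2004, Lemma 4.4, p. 11: "Suppose 𝓔
has a place of good reduction at `(T - t₀)`, `t₀ ∈ K`. Then there is a neighbourhood `U` of `t₀` on
which `W(𝓔(t))` is constant", via Prop. 4.2, p. 10, since every `E_t`, `t ∈ ℤ₂`, has potentially good
reduction at 2: `v₂(j) = 6` for even `t`, `7` for odd `t`) plus compactness of `ℤ₂` needs that NO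
`t₀ ∈ ℤ₂` is a singular fibre, i.e. `v₂(Δ(E_t))` bounded on `ℤ`. Below: it is (`≤ 8`, attained at odd
`t`), because `Δ(E_t) = -64(t²+1)²` and `4 ∤ t²+1` — this is exactly the hypothesis of the tree lemma
`Literature.NumberTheory.EllipticCurves.polyCurve_Δ_ne_zero_of_forall_not_mem_pow` at `v = 2`; and it
FAILS for the sister pencil `F_t : y² = x(x² + 2tx + t² - 1)` (dual locus `b' = 4`, equally constant),
whose fibre `t = 1` is singular and whose `v₂(Δ(F_t)) = v₂(64(t²-1)²)` is unbounded — there local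
constancy holds only on `ℤ₂ ∖ {±1}` and the analogue of the crux is expected to fail (PARI control
experiment in §5). Reduction types of `E_t` at 2 by Tate's algorithm (hand computation, for the record
and checked against PARI `elllocalred` in §5): `t` odd — type III, `f₂ = 7` (`v₂(Δ, c₄, c₆) = (8, 5, 7)`,
`b₈ = -a₄²` with `v₂ = 2`); `t` even — type II, `f₂ = 6` (`(6, 4, ≥ 7)`; after moving the singular
point `(1, 0)` to the origin `a₆ = 2(2u²+2u+1)`, `v₂ = 1`). So `N(E_t) = 2^{f₂} · ∏_{odd p ∣ t²+1} p`. -/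

namespace Fibres


/-- The pencil over an arbitrary commutative ring. -/
abbrev Eint {R : Type*} [CommRing R] (t : R) : WeierstrassCurve R := ⟨0, 2 * t, 0, t ^ 2 + 1, 0⟩

theorem Eint_Δ {R : Type*} [CommRing R] (t : R) : (Eint t).Δ = -(64 * (t ^ 2 + 1) ^ 2) := by
  simp only [WeierstrassCurve.Δ, WeierstrassCurve.b₂, WeierstrassCurve.b₄, WeierstrassCurve.b₆,
    WeierstrassCurve.b₈]
  ring

theorem Eint_c₄ {R : Type*} [CommRing R] (t : R) : (Eint t).c₄ = 16 * (t ^ 2 - 3) := by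
  simp only [WeierstrassCurve.c₄, WeierstrassCurve.b₂, WeierstrassCurve.b₄]
  ring

/-- `4 ∤ t² + 1` for every integer `t`. -/
theorem four_not_dvd_sq_add_one (t : ℤ) : ¬ (4 : ℤ) ∣ t ^ 2 + 1 := by
  intro h
  have h4 : (t ^ 2 + 1) % 4 = 0 := Int.emod_eq_zero_of_dvd h
  have : t % 4 = 0 ∨ t % 4 = 1 ∨ t % 4 = 2 ∨ t % 4 = 3 := by omega
  rcases this with h0 | h1 | h2 | h3
  · have : (t ^ 2 + 1) % 4 = 1 := by
      have : t ^ 2 % 4 = 0 := by rw [pow_two, Int.mul_emod, h0]; norm_num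
      omega
    omega
  · have : t ^ 2 % 4 = 1 := by rw [pow_two, Int.mul_emod, h1]; norm_num
    omega
  · have : t ^ 2 % 4 = 0 := by rw [pow_two, Int.mul_emod, h2]; norm_num
    omega
  · have : t ^ 2 % 4 = 1 := by rw [pow_two, Int.mul_emod, h3]; norm_num
    omega

/-- NO 2-ADIC SINGULAR FIBRE: `v₂(Δ(E_t)) ≤ 8` for every integer `t`, i.e. `2^9 ∤ Δ(E_t) = -64(t²+1)²`
(since `4 ∤ t²+1`). This is the load-bearing geometric input of the crux: it is exactly the
hypothesis of the tree's periodicity-extraction lemma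
`Literature.NumberTheory.EllipticCurves.polyCurve_Δ_ne_zero_of_forall_not_mem_pow` at `v = 2`. -/
theorem not_two_pow_nine_dvd_Δ (t : ℤ) : ¬ (2 : ℤ) ^ 9 ∣ (Eint t).Δ := by
  rw [Eint_Δ]
  intro h
  -- 2^9 ∣ 64 (t²+1)²  ⇒  8 ∣ (t²+1)²  ⇒  2 ∣ t²+1 twice... we show 4 ∣ (t²+1)² ⇒ 2 ∣ t²+1, then 16 ∤ ...
  have h' : (2 : ℤ) ^ 9 ∣ 64 * (t ^ 2 + 1) ^ 2 := (dvd_neg.mp h)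
  have h8 : (8 : ℤ) ∣ (t ^ 2 + 1) ^ 2 := by
    have : (2 : ℤ) ^ 9 = 64 * 8 := by norm_num
    rw [this] at h'
    exact (mul_dvd_mul_iff_left (by norm_num : (64 : ℤ) ≠ 0)).mp h'
  -- if 8 ∣ n² then 4 ∣ n... in fact 2 ∣ n, and then n = 2m with 2 ∣ m², so 2 ∣ m, so 4 ∣ n
  have h2 : (2 : ℤ) ∣ t ^ 2 + 1 := by
    have : (2 : ℤ) ∣ (t ^ 2 + 1) ^ 2 := dvd_trans (by norm_num) h8
    exact Int.Prime.dvd_pow' Nat.prime_two this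
  obtain ⟨m, hm⟩ := h2
  have h8' : (8 : ℤ) ∣ 4 * m ^ 2 := by rw [hm] at h8; convert h8 using 1; ring
  have h2m : (2 : ℤ) ∣ m ^ 2 := by
    have : (8 : ℤ) = 4 * 2 := by norm_num
    rw [this] at h8'
    exact (mul_dvd_mul_iff_left (by norm_num : (4 : ℤ) ≠ 0)).mp h8'
  have hm2 : (2 : ℤ) ∣ m := Int.Prime.dvd_pow' Nat.prime_two h2m
  obtain ⟨k, hk⟩ := hm2
  exact four_not_dvd_sq_add_one t ⟨k, by rw [hm, hk]; ring⟩

/-- … while `2^6 ∣ Δ(E_t)` always and `2^8 ∣ Δ(E_t)` for odd `t`: the bound `8` is attained. -/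
theorem two_pow_eight_dvd_Δ_of_odd (t : ℤ) (ht : Odd t) : (2 : ℤ) ^ 8 ∣ (Eint t).Δ := by
  rw [Eint_Δ, dvd_neg]
  obtain ⟨k, hk⟩ := ht
  subst hk
  exact ⟨(2 * k ^ 2 + 2 * k + 1) ^ 2, by ring⟩

/-- THE SISTER PENCIL `F_t : y² = x(x² + 2tx + t² - 1) = x(x+t-1)(x+t+1)` (dual locus `b' = 4`, also
constant) HAS 2-adically singular fibres: `F_1` (and `F_{-1}`) is singular, `Δ(F_t) = 64(t²-1)²`, so
`v₂(Δ(F_t))` is unbounded on `t ∈ ℤ` and Helfgott's Lemma 4.4 gives local constancy only on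
`ℤ₂ ∖ {±1}`, not uniformly: the analogue of the crux for `F_t` is expected to FAIL (PARI control
experiment, §5). -/
abbrev Fint {R : Type*} [CommRing R] (t : R) : WeierstrassCurve R := ⟨0, 2 * t, 0, t ^ 2 - 1, 0⟩

theorem Fint_Δ {R : Type*} [CommRing R] (t : R) : (Fint t).Δ = 64 * (t ^ 2 - 1) ^ 2 := by
  simp only [WeierstrassCurve.Δ, WeierstrassCurve.b₂, WeierstrassCurve.b₄, WeierstrassCurve.b₆,
    WeierstrassCurve.b₈]
  ring

theorem Fint_one_singular : (Fint (1 : ℚ)).Δ = 0 := by rw [Fint_Δ]; norm_num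

/-- Unboundedness of `v₂(Δ(F_t))`: for every `n`, `2^n ∣ Δ(F_{1 + 2^n})`. -/
theorem two_pow_dvd_Δ_sister (n : ℕ) : (2 : ℤ) ^ n ∣ (Fint (1 + 2 ^ n : ℤ)).Δ := by
  rw [Fint_Δ]
  exact ⟨64 * (2 + 2 ^ n) ^ 2 * 2 ^ n, by ring⟩


end Fibres

/-! ## §3 The weakening the tree facts deliver: any period -/

/-- ANY-PERIOD form: `∃ N ≥ 1, ∃ w N-periodic, …`. Logically WEAKER than the crux (a `2^M` period is a
period) and NOT formally equivalent (a non-constant 3-periodic sign is not `2^M`-periodic); it is what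
the tree's named facts give without further input: `Literature.NumberTheory.EllipticCurves.p_parity`
(2-parity) and `Helfgott2004_exists_local_tables_locallyConstant` (product formula with `±1` tables
`w_v`, tied to Rohrlich's `localRootNumber` ONLY in residue characteristic `> 3` — clause (3) —, and
`v`-adically locally constant — clause (5)) yield `(-1)^corank(E_t) = -w₂(E_t)·w₃(E_t)·(-1)^{ω_odd}`
(`3 ∤ t²+1`, so `E_t` has good reduction at 3 but the table `w₃` is not pinned to `+1` there), with
`w₂(E_·)` `2^M`-periodic and `w₃(E_·)` `3^K`-periodic by
`exists_forall_sub_mem_pow_imp_eq_of_locallyConstant`; hence period `2^M·3^K`. For the same downstream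
use (sums over `t` in arithmetic progressions) any period serves. Interface note, not a falsity. -/
def AnyPeriod : Prop :=
  ∃ N : ℕ, 0 < N ∧ ∃ w : ℕ → ℤ, (∀ t : ℕ, w (t + N) = w t) ∧ ∀ t : ℕ, 1 ≤ t →
    (-1 : ℤ) ^ (WeierstrassCurve.selmerCorank (⟨0, 2 * (t : ℚ), 0, (t : ℚ) ^ 2 + 1, 0⟩ :
      WeierstrassCurve ℚ) 2) =
      -(w t * (-1 : ℤ) ^ (((t ^ 2 + 1).primeFactors.filter (fun p : ℕ => p ≠ 2)).card))

/-- The crux implies its any-period form. [folklore] -/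
theorem anyPeriod_of (h : PencilSelmerDictionary) : AnyPeriod := by
  obtain ⟨M, w, hw, h⟩ := h
  exact ⟨2 ^ M, Nat.two_pow_pos M, w, hw, h⟩

/-- The any-period form is STRICTLY weaker as a matter of logic: for the abstract shape there are
exponent functions (`c t = [3 ∣ t]`, `k = 0`) for which the any-period statement holds (period 3)
while the `2^M` statement fails for every `M` (compare `t = 3` with `t = 3 + 2^M`, and `3 ∤ 2^M`).
So the planner's `2^M` records genuinely 2-adic information (the conductor of the periodicity is a
power of 2 because only `W₂` varies), which the `AnyPeriod` restatement would discard. [folklore] -/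
theorem anyPeriod_shape_not_imp_pow_two_shape :
    ∃ c k : ℕ → ℕ,
      (∃ N : ℕ, 0 < N ∧ ∃ w : ℕ → ℤ, (∀ t : ℕ, w (t + N) = w t) ∧
          ∀ t : ℕ, 1 ≤ t → (-1 : ℤ) ^ c t = -(w t * (-1 : ℤ) ^ k t)) ∧
        ¬ ∃ M : ℕ, ∃ w : ℕ → ℤ, (∀ t : ℕ, w (t + 2 ^ M) = w t) ∧
          ∀ t : ℕ, 1 ≤ t → (-1 : ℤ) ^ c t = -(w t * (-1 : ℤ) ^ k t) := by
  refine ⟨fun t => if 3 ∣ t then 1 else 0, fun _ => 0,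
    ⟨3, by norm_num, fun t => -(-1 : ℤ) ^ (if 3 ∣ t then 1 else 0), fun t => ?_, fun t _ => ?_⟩, ?_⟩
  · -- 3-periodicity of the witness
    have e : (3 ∣ t + 3) ↔ (3 ∣ t) := Nat.dvd_add_self_right
    show -(-1 : ℤ) ^ (if 3 ∣ t + 3 then 1 else 0) = -(-1 : ℤ) ^ (if 3 ∣ t then 1 else 0)
    simp only [e]
  · show (-1 : ℤ) ^ (if 3 ∣ t then 1 else 0) = -(-(-1 : ℤ) ^ (if 3 ∣ t then 1 else 0) * (-1 : ℤ) ^ 0)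
    rw [pow_zero, mul_one, neg_neg]
  · rintro ⟨M, w, hw, h⟩
    have h3 := h 3 (by norm_num)
    have h3' := h (3 + 2 ^ M) (Nat.succ_le_of_lt (by positivity))
    have hndvd : ¬ (3 ∣ 3 + 2 ^ M) := by
      intro hd
      have h2M : 3 ∣ 2 ^ M := (Nat.dvd_add_right (dvd_refl 3)).mp hd
      have h32 : 3 ∣ 2 := Nat.Prime.dvd_of_dvd_pow Nat.prime_three h2M
      omega
    dsimp only at h3 h3'
    rw [if_pos (dvd_refl 3)] at h3
    rw [if_neg hndvd, hw] at h3'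
    simp only [pow_one, pow_zero, mul_one] at h3 h3'
    omega


/-! ## §3b The local-tables fact does not pin `w₃`: global flip symmetry (Lean-certified)

The named fact `Literature.NumberTheory.EllipticCurves.Helfgott2004_exists_local_tables_locallyConstant`
(product formula with `±1` local tables `w_v`, tied to Rohrlich's `localRootNumber` in residue
characteristic `> 3`, `v`-adically locally constant) is the tree's only source of local root numbers at
`2` and `3`. Its clause set is invariant under negating the tables at `2` AND at `3` simultaneously
(`helfgottClauses_flip`): the product over all places changes by `(-1)·(-1) = 1`, clause (3) never
mentions `v ∣ 6`, and `±1`-valuedness, invariance and local constancy are sign-blind. Hence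
(`exists_witnesses_opposite_at_three`) the fact has, with every witness, another witness whose table
at `3` is the opposite sign on any given curve: NO statement of the form "`w₃(W') = +1` for `W'` with
good reduction at `3`" is derivable from it. What a proof of the crux needs is the flip-INVARIANT
statement "`t ↦ w₂(E_t ⊗ ℚ₂)·w₃(E_t ⊗ ℚ₃)` is `2^M`-periodic", true in every witness (each witness is
`±` the Deligne–Langlands tables, for which `W₃ = +1` at good reduction) but with no evident
derivation from the clauses: the natural repair is one extra clause in the Literature fact
(`W'` good reduction ⇒ `w_v W' = 1`, every `v`; Rohrlich 1994 §19 / Deligne 1973, true for the genuine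
local constants) or the `AnyPeriod` restatement of the crux (§3). -/

namespace Tables

open IsDedekindDomain WeierstrassCurve Literature.NumberTheory.EllipticCurves
open scoped Classical


/-- The place `(p)` of `ℤ` for a prime `p`. -/
def intPlace (p : ℕ) (hp : p.Prime) : HeightOneSpectrum ℤ where
  asIdeal := Ideal.span {(p : ℤ)}
  isPrime := (Ideal.span_singleton_prime (by exact_mod_cast hp.ne_zero)).mpr
    (Nat.prime_iff_prime_int.mp hp)
  ne_bot := by
    rw [Ne, Ideal.span_singleton_eq_bot]
    exact_mod_cast hp.ne_zero

theorem ringChar_intPlace (p : ℕ) (hp : p.Prime) :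
    ringChar (ℤ ⧸ (intPlace p hp).asIdeal) = p := by
  haveI : CharP (ℤ ⧸ (intPlace p hp).asIdeal) p :=
    charP_of_injective_ringHom (f := (Int.quotientSpanNatEquivZMod p).symm.toRingHom)
      (Int.quotientSpanNatEquivZMod p).symm.injective p
  exact ringChar.eq _ p

def v2 : HeightOneSpectrum ℤ := intPlace 2 Nat.prime_two
def v3 : HeightOneSpectrum ℤ := intPlace 3 Nat.prime_three

theorem ringChar_v2 : ringChar (ℤ ⧸ v2.asIdeal) = 2 := ringChar_intPlace 2 _
theorem ringChar_v3 : ringChar (ℤ ⧸ v3.asIdeal) = 3 := ringChar_intPlace 3 _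

theorem v2_ne_v3 : v2 ≠ v3 := by
  intro h
  have := congrArg (fun v : HeightOneSpectrum ℤ => ringChar (ℤ ⧸ v.asIdeal)) h
  simp only [ringChar_v2, ringChar_v3] at this
  omega




/-- The five clauses of `Helfgott2004_exists_local_tables_locallyConstant`, as a predicate on the
family of local tables `w`. -/
def HelfgottClauses
    (w : (v : HeightOneSpectrum ℤ) → WeierstrassCurve (v.adicCompletion ℚ) → ℤ) : Prop :=
  (∀ v W', w v W' = 1 ∨ w v W' = -1) ∧
  (∀ v W' (C : VariableChange (v.adicCompletion ℚ)), w v (C • W') = w v W') ∧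
  (∀ v (W' : WeierstrassCurve (v.adicCompletion ℚ)), W'.IsElliptic →
    3 < ringChar (ℤ ⧸ v.asIdeal) → w v W' = W'.localRootNumber (v.adicCompletionIntegers ℚ)) ∧
  (∀ W : WeierstrassCurve ℚ, W.IsElliptic →
    W.rootNumber = -∏ᶠ v : HeightOneSpectrum ℤ, w v (W.baseChange (v.adicCompletion ℚ))) ∧
  ∀ (v : HeightOneSpectrum ℤ) (W' : WeierstrassCurve (v.adicCompletion ℚ)), W'.IsElliptic →
    W'.a₁ ∈ v.adicCompletionIntegers ℚ → W'.a₂ ∈ v.adicCompletionIntegers ℚ →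
    W'.a₃ ∈ v.adicCompletionIntegers ℚ → W'.a₄ ∈ v.adicCompletionIntegers ℚ →
    W'.a₆ ∈ v.adicCompletionIntegers ℚ →
    ∃ n : ℕ,
      ∀ W'' : WeierstrassCurve (v.adicCompletion ℚ), W''.IsElliptic →
        W''.a₁ ∈ v.adicCompletionIntegers ℚ → W''.a₂ ∈ v.adicCompletionIntegers ℚ →
        W''.a₃ ∈ v.adicCompletionIntegers ℚ → W''.a₄ ∈ v.adicCompletionIntegers ℚ →
        W''.a₆ ∈ v.adicCompletionIntegers ℚ →
        Valued.v (W''.a₁ - W'.a₁) < WithZero.exp (-(n : ℤ)) →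
        Valued.v (W''.a₂ - W'.a₂) < WithZero.exp (-(n : ℤ)) →
        Valued.v (W''.a₃ - W'.a₃) < WithZero.exp (-(n : ℤ)) →
        Valued.v (W''.a₄ - W'.a₄) < WithZero.exp (-(n : ℤ)) →
        Valued.v (W''.a₆ - W'.a₆) < WithZero.exp (-(n : ℤ)) → w v W'' = w v W'

/-- Faithfulness: the named fact is literally `∃ w, HelfgottClauses w`. -/
theorem helfgott_fact_iff :
    Helfgott2004_exists_local_tables_locallyConstant ↔ ∃ w, HelfgottClauses w := Iff.rfl

/-- The global flip sign: `-1` at the places above `2` and `3`, `+1` elsewhere. -/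
noncomputable def flipSign (v : HeightOneSpectrum ℤ) : ℤ := if v = v2 ∨ v = v3 then -1 else 1

theorem flipSign_v2 : flipSign v2 = -1 := by simp [flipSign]
theorem flipSign_v3 : flipSign v3 = -1 := by simp [flipSign]

theorem flipSign_of_three_lt {v : HeightOneSpectrum ℤ} (h : 3 < ringChar (ℤ ⧸ v.asIdeal)) :
    flipSign v = 1 := by
  unfold flipSign
  rw [if_neg]
  rintro (rfl | rfl)
  · rw [ringChar_v2] at h; omega
  · rw [ringChar_v3] at h; omega

theorem mulSupport_flipSign_subset : Function.mulSupport flipSign ⊆ (({v2, v3} : Finset _) : Set _) := by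
  intro v hv
  rw [Function.mem_mulSupport] at hv
  unfold flipSign at hv
  by_cases h : v = v2 ∨ v = v3
  · rcases h with rfl | rfl <;> simp
  · rw [if_neg h] at hv; exact absurd rfl hv

theorem finprod_flipSign : ∏ᶠ v, flipSign v = 1 := by
  classical
  rw [finprod_eq_prod_of_mulSupport_subset _ mulSupport_flipSign_subset,
    Finset.prod_pair v2_ne_v3, flipSign_v2, flipSign_v3]
  norm_num

/-- Flipping a `±1`-valued function at the two places `2, 3` does not change its `finprod`. -/
theorem finprod_flipSign_mul (g : HeightOneSpectrum ℤ → ℤ) :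
    ∏ᶠ v, flipSign v * g v = ∏ᶠ v, g v := by
  classical
  by_cases hg : (Function.mulSupport g).Finite
  · rw [finprod_mul_distrib ((Finset.finite_toSet _).subset mulSupport_flipSign_subset) hg,
      finprod_flipSign, one_mul]
  · -- both sides are the junk value `1`
    have hg' : (Function.mulSupport fun v => flipSign v * g v).Infinite := by
      intro hfin
      apply hg
      apply (hfin.union (Finset.finite_toSet ({v2, v3} : Finset _))).subset
      intro v hv
      by_cases h : v ∈ (({v2, v3} : Finset _) : Set _)
      · exact Or.inr h
      · left
        rw [Function.mem_mulSupport] at hv ⊢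
        have : flipSign v = 1 := by
          by_contra hne
          exact h (mulSupport_flipSign_subset hne)
        rwa [this, one_mul]
    rw [finprod_of_infinite_mulSupport hg', finprod_of_infinite_mulSupport hg]

/-- The flipped tables. -/
noncomputable def flip (w : (v : HeightOneSpectrum ℤ) → WeierstrassCurve (v.adicCompletion ℚ) → ℤ) :
    (v : HeightOneSpectrum ℤ) → WeierstrassCurve (v.adicCompletion ℚ) → ℤ :=
  fun v W' => flipSign v * w v W'

/-- GLOBAL FLIP SYMMETRY of the clause set: if `w` satisfies the five clauses then so does the family
with the tables at `2` AND `3` negated. Consequently no statement pinning `w₃` (or `w₂`) alone — e.g.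
`w₃(W') = +1` for a curve with good reduction at `3` — is derivable from the named fact. -/
theorem helfgottClauses_flip (w) (h : HelfgottClauses w) : HelfgottClauses (flip w) := by
  obtain ⟨h1, h2, h3, h4, h5⟩ := h
  refine ⟨fun v W' => ?_, fun v W' C => ?_, fun v W' hE hv => ?_, fun W hW => ?_,
    fun v W' hE ha1 ha2 ha3 ha4 ha6 => ?_⟩
  · unfold flip flipSign
    rcases h1 v W' with h | h <;> split_ifs <;> simp [h]
  · unfold flip; rw [h2]
  · unfold flip; rw [flipSign_of_three_lt hv, one_mul, h3 v W' hE hv]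
  · unfold flip
    rw [finprod_flipSign_mul (fun v => w v (W.baseChange (v.adicCompletion ℚ)))]
    exact h4 W hW
  · obtain ⟨n, hn⟩ := h5 v W' hE ha1 ha2 ha3 ha4 ha6
    refine ⟨n, fun W'' hE'' hb1 hb2 hb3 hb4 hb6 hc1 hc2 hc3 hc4 hc6 => ?_⟩
    unfold flip
    rw [hn W'' hE'' hb1 hb2 hb3 hb4 hb6 hc1 hc2 hc3 hc4 hc6]

/-- In particular the tables at `3` of a witness and of its flip disagree in sign everywhere. -/
theorem flip_v3 (w) (W' : WeierstrassCurve (v3.adicCompletion ℚ)) : flip w v3 W' = -w v3 W' := by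
  simp [flip, flipSign_v3]


/-- NON-PINNING, formally: granted the named fact, for every curve `W'` over `ℚ₃` there are two
witnessing table families whose values at `W'` (place `3`) are opposite. [folklore] -/
theorem exists_witnesses_opposite_at_three (h : Helfgott2004_exists_local_tables_locallyConstant)
    (W' : WeierstrassCurve (v3.adicCompletion ℚ)) :
    ∃ w₁ w₂, HelfgottClauses w₁ ∧ HelfgottClauses w₂ ∧ w₂ v3 W' = -w₁ v3 W' := by
  obtain ⟨w, hw⟩ := helfgott_fact_iff.mp h
  exact ⟨w, flip w, hw, helfgottClauses_flip w hw, flip_v3 w W'⟩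

end Tables

/-! ## §4 Sharp form: explicit witness table -/

/-- SHARP FORM with an explicit residue table: `w t = tab (t % 2^M)`. The PARI numerics (§5) suggest
the least admissible `M` and the table (= the local root number `W₂(E_t)` as a function of
`t mod 2^M`); a prover closes the crux by `of_sharp M₀ wTable _`. -/
def Sharp (M : ℕ) (tab : ℕ → ℤ) : Prop :=
  ∀ t : ℕ, 1 ≤ t →
    (-1 : ℤ) ^ (WeierstrassCurve.selmerCorank (⟨0, 2 * (t : ℚ), 0, (t : ℚ) ^ 2 + 1, 0⟩ :
      WeierstrassCurve ℚ) 2) =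
      -(tab (t % 2 ^ M) * (-1 : ℤ) ^ (((t ^ 2 + 1).primeFactors.filter (fun p : ℕ => p ≠ 2)).card))

/-- A sharp table closes the crux. [folklore] -/
theorem of_sharp (M : ℕ) (tab : ℕ → ℤ) (h : Sharp M tab) : PencilSelmerDictionary :=
  abstract_of_sharp corank omegaOdd M tab h


/-! ## §4b TIGHTNESS (Lean-certified, granted Cassels' formula): the least period is `≥ 4` (`= 4` conjecturally)

Root-number-free attack on the SELMER side. The tree's `TwoIsogenySelmerGroup.lean` gives the explicit
descent sets `S(a, b)` (squarefree `d ∣ b` with `w² = d u⁴ + a u²z² + (b/d) z⁴` everywhere locally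
soluble) and the named fact `cassels_selmerCorank_two_parity`:
`(-1)^{corank Sel_{2^∞}(E)} = (-1)^{dim S(a,b) + dim S(-2a, a²-4b)}` for `E = ⟨0, a, 0, b, 0⟩`. For the
pencil (`a = 2t`, `b = t²+1`, dual locus `a² - 4b = -4`) we COMPUTE both sets at `t = 1, 2, 3, 4` in Lean:
negative divisors of `t²+1` die at `∞` (`not_isSoluble_real_of_negDef`: `a² - 4dd' = -4 < 0`, `d < 0`),
the classes `±2` of `S(-4t, -4)` die at `2` for `t = 1, 2, 3` (reduction modulo `16`/`32`, `decide`,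
via `not_isSoluble_padic_of_zmod` — a general "no solution mod `p^k` in either affine chart ⇒ no
`ℚ_p`-point" lemma over the tree's `isSoluble_map_coe_iff`) and are GLOBAL at `t = 4`
(`4² = 2·3⁴ - 16·3² - 2`), while `2, 5 ∉ S(6, 10)` (mod 16). Outcome (`corank_E1_even`, `corank_E2_even`,
`corank_E3_even`, `corank_E4_odd`, and `t = 5..8` likewise — at `t = 7, 8` the classes `±2` of `S(-4t,-4)`
pass modulo powers of `2` and die at `p = 5 ∣ t²+1`): the Selmer-side sign `(-1)^{corank + ω_odd}` is
`+1, -1, -1, +1, +1, -1, -1, +1` at `t = 1, …, 8`. Consequences: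
* `not_pencilSelmerDictionaryWith_one` / `_zero`: the crux is FALSE with `M ≤ 1` (`t = 2` vs `t = 4`):
  the natural strengthening "period 2" is refuted, so the least admissible `M` is `≥ 2`;
* `forced_w_values`: ANY witness `(M, w)` of the crux has `(w 1, w 2, w 3, w 4) = (-1, 1, 1, -1)`, i.e.
  agrees with the table `w = (-1, -1, +1, +1)` on `t mod 4 = (0, 1, 2, 3)` found numerically by the crux
  ideator (card `cassels-local-images-mod4`, job j004946: period 4 on `t ≤ 4000`) — `sharp_table_holds_upto_four`;
  `forced_w_values_upto_eight/_twelve` / `sharp_table_holds_upto_eight/_twelve` extend this to THREE full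
  periods (`t ≤ 12`; at `t = 9` the classes `2, 41 ∈ S(18, 82)` are global: `29² = 2·4⁴ + 18·4² + 41`).
  `Descent.not_liouvilleVariantWith_of_le_two`: the Ω-variant (multiplicities) already fails at period 4.
* `not_liouvilleVariantWith_of_le_two`: the `Ω`/λ-VARIANT (prime factors with multiplicity) is FALSE
  for every `M ≤ 2` (`t = 3`: `10`, `Ω = 2` vs `t = 7`: `50 = 2·5²`, `Ω = 3`, both coranks even) — the
  `ω`/`μ` currency of the route is forced; the square factor `5² ∣ 7²+1` separates `λ` from `μ·(-1)^ω`.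
In root-number currency §4b says `W₂(E_t) = -1, +1, +1, -1` repeating, for `t = 1, …, 12` (consistent
with the §5 prediction `W₂ = -1` on `8 ∣ t`). All of §4b is conditional only on the named fact (a theorem in
print: Cassels 1965; Dokchitser–Dokchitser 2011 Thm 30); axioms standard. -/

namespace Descent

open Literature.NumberTheory.EllipticCurves


/-! ### 2-adic insolubility by reduction modulo `2^k` -/

/-- Reduction of a `ℚ_p`-solubility witness modulo `p^k`: if `z² = f(x, y)` is soluble over `ℚ_p` for an
integral form `f`, then one of the two affine charts has a solution modulo `p^k`. Contrapositive form,
with decidable hypotheses. [folklore] -/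
theorem not_isSoluble_padic_of_zmod (p : ℕ) [Fact p.Prime] (k : ℕ) (f : BinaryQuartic ℤ)
    (h1 : ∀ a b : ZMod (p ^ k), b ^ 2 ≠ (f.map (Int.castRingHom (ZMod (p ^ k)))).eval 1 a)
    (h2 : ∀ a b : ZMod (p ^ k), b ^ 2 ≠ (f.map (Int.castRingHom (ZMod (p ^ k)))).eval a 1) :
    ¬ (f.map (Int.castRingHom ℚ_[p])).IsSoluble := by
  intro hs
  rw [← BinaryQuartic.map_intCast_map_coe] at hs
  set φ : ℤ_[p] →+* ZMod (p ^ k) := PadicInt.toZModPow k with hφ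
  have hcomp : φ.comp (Int.castRingHom ℤ_[p]) = Int.castRingHom (ZMod (p ^ k)) := RingHom.ext_int _ _
  have hmap : (f.map (Int.castRingHom ℤ_[p])).map φ = f.map (Int.castRingHom (ZMod (p ^ k))) := by
    rw [← hcomp]; rfl
  rcases (BinaryQuartic.isSoluble_map_coe_iff _).mp hs with ⟨t, z, h⟩ | ⟨t, z, h⟩
  · apply h1 (φ t) (φ z)
    have := congrArg φ h
    rw [map_pow, ← BinaryQuartic.eval_map φ, map_one, hmap] at this
    exact this
  · apply h2 (φ t) (φ z)
    have := congrArg φ h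
    rw [map_pow, ← BinaryQuartic.eval_map φ, map_one, hmap] at this
    exact this

/-- `w² = 2u⁴ - 8u²z² - 2z⁴` (the space `d = 2` of the descent on the divisors of `b' = -4` for
`E_2 : a' = -8`) has no point over `ℚ₂` (obstruction modulo 16). -/
theorem not_isSoluble_two_E2_d2 :
    ¬ ((twoIsogenyQuartic (-8) 2 (-2)).map (Int.castRingHom ℚ_[2])).IsSoluble := by
  apply not_isSoluble_padic_of_zmod 2 4
  · decide
  · decide

theorem not_isSoluble_two_E2_dneg2 :
    ¬ ((twoIsogenyQuartic (-8) (-2) 2).map (Int.castRingHom ℚ_[2])).IsSoluble := by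
  apply not_isSoluble_padic_of_zmod 2 4
  · decide
  · decide



/-! ### Real insolubility of negative-definite spaces -/

/-- If `d < 0` and `a² < 4 d d'` the form `d u⁴ + a u²z² + d' z⁴` is negative definite, so
`w² = q(u, z)` has no real point off the origin. (Covers the negative divisors in the descent on the
divisors of `b = t² + 1` for `E_t`, where `a = 2t > 0` and `a² - 4dd' = -4`.) [folklore] -/
theorem not_isSoluble_real_of_negDef {a d d' : ℤ} (hd : d < 0) (hdisc : a ^ 2 < 4 * d * d') :
    ¬ ((twoIsogenyQuartic a d d').map (Int.castRingHom ℝ)).IsSoluble := by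
  rintro ⟨u, z, w, h0, h⟩
  rw [eval_map_twoIsogenyQuartic] at h
  simp only [eq_intCast] at h
  have hd₁ : (d : ℝ) < 0 := by exact_mod_cast hd
  have hdisc₁ : ((a : ℝ)) ^ 2 < 4 * d * d' := by exact_mod_cast hdisc
  have key : 4 * (d : ℝ) * w ^ 2 = (2 * d * u ^ 2 + a * z ^ 2) ^ 2 + (4 * d * d' - a ^ 2) * z ^ 4 := by
    rw [h]; ring
  have h1 : 4 * (d : ℝ) * w ^ 2 ≤ 0 := by nlinarith [sq_nonneg w]
  have h2 : 0 ≤ (2 * (d : ℝ) * u ^ 2 + a * z ^ 2) ^ 2 := sq_nonneg _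
  have h3 : 0 ≤ (4 * (d : ℝ) * d' - a ^ 2) * z ^ 4 := mul_nonneg (by linarith) (by positivity)
  have hz4 : (4 * (d : ℝ) * d' - a ^ 2) * z ^ 4 = 0 := by linarith
  have hz : z = 0 := by
    rcases mul_eq_zero.mp hz4 with h' | h'
    · linarith
    · exact (pow_eq_zero_iff (by norm_num)).mp h'
  have hsq : (2 * (d : ℝ) * u ^ 2 + a * z ^ 2) ^ 2 = 0 := by linarith
  rw [hz] at hsq
  have hu : u = 0 := by
    have : 2 * (d : ℝ) * u ^ 2 = 0 := by simpa using hsq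
    rcases mul_eq_zero.mp this with h' | h'
    · exfalso; linarith
    · exact (pow_eq_zero_iff (by norm_num)).mp h'
  rcases h0 with h' | h'
  · exact h' hu
  · exact h' hz

/-! ### Global points give local solubility -/

/-- An integral point `z² = f(x, y)`, `(x, y) ≠ (0, 0)`, makes `f` everywhere locally soluble. [folklore] -/
theorem isLocallySoluble_of_int_point (f : BinaryQuartic ℤ) {x y z : ℤ} (hxy : x ≠ 0 ∨ y ≠ 0)
    (h : z ^ 2 = f.eval x y) : f.IsLocallySoluble := by
  have hne : ∀ {R : Type} [CommRing R] [CharZero R], ((x : R) ≠ 0 ∨ (y : R) ≠ 0) := by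
    intro R _ _
    rcases hxy with hx | hy
    · exact Or.inl (by exact_mod_cast hx)
    · exact Or.inr (by exact_mod_cast hy)
  have hev : ∀ {R : Type} [CommRing R], ((z : R)) ^ 2 = (f.map (Int.castRingHom R)).eval x y := by
    intro R _
    have e := BinaryQuartic.eval_map (Int.castRingHom R) f x y
    simp only [eq_intCast] at e
    rw [e, ← h, Int.cast_pow]
  exact ⟨⟨x, y, z, hne, hev⟩, fun p _ => ⟨x, y, z, hne, hev⟩⟩

/-! ### Squarefree bookkeeping -/

theorem prime_int_of_nat {q : ℕ} (hq : q.Prime) : Prime (q : ℤ) :=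
  Int.prime_iff_natAbs_prime.mpr (by simpa using hq)

theorem squarefree_neg_one : Squarefree (-1 : ℤ) := isUnit_one.neg.squarefree
theorem squarefree_two : Squarefree (2 : ℤ) := Int.prime_two.squarefree
theorem squarefree_neg_two : Squarefree (-2 : ℤ) := (Prime.neg Int.prime_two).squarefree
theorem squarefree_five : Squarefree (5 : ℤ) := (prime_int_of_nat (by norm_num)).squarefree
theorem squarefree_seventeen : Squarefree (17 : ℤ) := (prime_int_of_nat (by norm_num)).squarefree
theorem not_squarefree_four : ¬ Squarefree (4 : ℤ) := fun h => by
  have h2 : IsUnit (2 : ℤ) := h 2 ⟨1, by norm_num⟩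
  rcases Int.isUnit_iff.mp h2 with h' | h' <;> omega
theorem not_squarefree_neg_four : ¬ Squarefree (-4 : ℤ) := fun h => by
  have h2 : IsUnit (2 : ℤ) := h 2 ⟨-1, by norm_num⟩
  rcases Int.isUnit_iff.mp h2 with h' | h' <;> omega

/-- Squarefree divisors of `-4` are `±1, ±2`. -/
theorem eq_of_squarefree_dvd_neg_four {d : ℤ} (hsf : Squarefree d) (hdvd : d ∣ -4) :
    d = 1 ∨ d = -1 ∨ d = 2 ∨ d = -2 := by
  have hn : d.natAbs ∣ 4 := by
    have := Int.natAbs_dvd_natAbs.mpr hdvd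
    simpa using this
  have hmem : d.natAbs ∈ Nat.divisors 4 := Nat.mem_divisors.mpr ⟨hn, by norm_num⟩
  have h4 : d ≠ 4 := fun h => not_squarefree_four (h ▸ hsf)
  have h4' : d ≠ -4 := fun h => not_squarefree_neg_four (h ▸ hsf)
  have : Nat.divisors 4 = {1, 2, 4} := by decide
  rw [this] at hmem
  simp only [Finset.mem_insert, Finset.mem_singleton] at hmem
  omega

/-- Divisors of a prime `q` (as integers): `±1, ±q`. -/
theorem eq_of_dvd_prime {d : ℤ} {q : ℕ} (hq : q.Prime) (hdvd : d ∣ (q : ℤ)) :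
    d = 1 ∨ d = -1 ∨ d = q ∨ d = -q := by
  have hn : d.natAbs ∣ q := by
    have := Int.natAbs_dvd_natAbs.mpr hdvd
    simpa using this
  rcases (Nat.dvd_prime hq).mp hn with h | h <;> omega

/-! ### The four Selmer sets -/

/-- `S(4, 5) = {1, 5}`: descent on the divisors of `b = 5` for `E_2 : y² = x³ + 4x² + 5x`. -/
theorem selmer_E2 : twoIsogenySelmerGroup 4 5 = {1, 5} := by
  ext d
  rw [mem_twoIsogenySelmerGroup_iff (by norm_num)]
  constructor
  · rintro ⟨hsf, hdvd, hloc⟩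
    rcases eq_of_dvd_prime Nat.prime_five (by exact_mod_cast hdvd) with rfl | rfl | rfl | rfl
    · simp
    · exact absurd hloc.1 (not_isSoluble_real_of_negDef (by norm_num) (by norm_num))
    · simp
    · exact absurd hloc.1 (not_isSoluble_real_of_negDef (by norm_num) (by norm_num))
  · intro hd
    simp only [Finset.mem_insert, Finset.mem_singleton] at hd
    rcases hd with rfl | rfl
    · exact (mem_twoIsogenySelmerGroup_iff (by norm_num)).mp (one_mem_twoIsogenySelmerGroup 4 (by norm_num))
    · exact (mem_twoIsogenySelmerGroup_iff (by norm_num)).mp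
        (self_mem_twoIsogenySelmerGroup 4 squarefree_five)

/-- `S(8, 17) = {1, 17}`: descent on the divisors of `b = 17` for `E_4 : y² = x³ + 8x² + 17x`. -/
theorem selmer_E4 : twoIsogenySelmerGroup 8 17 = {1, 17} := by
  ext d
  rw [mem_twoIsogenySelmerGroup_iff (by norm_num)]
  constructor
  · rintro ⟨hsf, hdvd, hloc⟩
    rcases eq_of_dvd_prime (by norm_num : Nat.Prime 17) (by exact_mod_cast hdvd) with
      rfl | rfl | rfl | rfl
    · simp
    · exact absurd hloc.1 (not_isSoluble_real_of_negDef (by norm_num) (by norm_num))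
    · simp
    · exact absurd hloc.1 (not_isSoluble_real_of_negDef (by norm_num) (by norm_num))
  · intro hd
    simp only [Finset.mem_insert, Finset.mem_singleton] at hd
    rcases hd with rfl | rfl
    · exact (mem_twoIsogenySelmerGroup_iff (by norm_num)).mp (one_mem_twoIsogenySelmerGroup 8 (by norm_num))
    · exact (mem_twoIsogenySelmerGroup_iff (by norm_num)).mp
        (self_mem_twoIsogenySelmerGroup 8 squarefree_seventeen)

/-- `S(-8, -4) = {1, -1}`: descent on the divisors of `b' = -4` for `E_2` (`a' = -8`); the classes
`±2` die at `2` (`not_isSoluble_two_E2_d2`, `not_isSoluble_two_E2_dneg2`). -/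
theorem selmer'_E2 : twoIsogenySelmerGroup (-8) (-4) = {1, -1} := by
  ext d
  rw [mem_twoIsogenySelmerGroup_iff (by norm_num)]
  constructor
  · rintro ⟨hsf, hdvd, hloc⟩
    rcases eq_of_squarefree_dvd_neg_four hsf hdvd with rfl | rfl | rfl | rfl
    · simp
    · simp
    · exact absurd (hloc.2 2) (by simpa using not_isSoluble_two_E2_d2)
    · exact absurd (hloc.2 2) (by simpa using not_isSoluble_two_E2_dneg2)
  · intro hd
    simp only [Finset.mem_insert, Finset.mem_singleton] at hd
    rcases hd with rfl | rfl
    · exact (mem_twoIsogenySelmerGroup_iff (by norm_num)).mp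
        (one_mem_twoIsogenySelmerGroup (-8) (by norm_num))
    · exact (mem_twoIsogenySelmerGroup_iff (by norm_num)).mp
        (mem_twoIsogenySelmerGroup_of_isSquare (by norm_num) squarefree_neg_one (by norm_num)
          ⟨2, by norm_num⟩)

/-- `S(-16, -4) = {1, -1, 2, -2}`: descent on the divisors of `b' = -4` for `E_4` (`a' = -16`); the
classes `±2` are GLOBAL: `4² = 2·3⁴ - 16·3² - 2` and `4² = -2 - 16·3² + 2·3⁴`. -/
theorem selmer'_E4 : twoIsogenySelmerGroup (-16) (-4) = {1, -1, 2, -2} := by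
  ext d
  rw [mem_twoIsogenySelmerGroup_iff (by norm_num)]
  constructor
  · rintro ⟨hsf, hdvd, hloc⟩
    rcases eq_of_squarefree_dvd_neg_four hsf hdvd with rfl | rfl | rfl | rfl <;> simp
  · intro hd
    simp only [Finset.mem_insert, Finset.mem_singleton] at hd
    rcases hd with rfl | rfl | rfl | rfl
    · exact (mem_twoIsogenySelmerGroup_iff (by norm_num)).mp
        (one_mem_twoIsogenySelmerGroup (-16) (by norm_num))
    · exact (mem_twoIsogenySelmerGroup_iff (by norm_num)).mp
        (mem_twoIsogenySelmerGroup_of_isSquare (by norm_num) squarefree_neg_one (by norm_num)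
          ⟨2, by norm_num⟩)
    · refine ⟨squarefree_two, by norm_num, ?_⟩
      exact isLocallySoluble_of_int_point _ (x := 3) (y := 1) (z := 4) (Or.inl (by norm_num))
        (by norm_num [twoIsogenyQuartic, BinaryQuartic.eval])
    · refine ⟨squarefree_neg_two, by norm_num, ?_⟩
      exact isLocallySoluble_of_int_point _ (x := 1) (y := 3) (z := 4) (Or.inl (by norm_num))
        (by norm_num [twoIsogenyQuartic, BinaryQuartic.eval])




/-! ### Ranks and Cassels parities at `t = 2` and `t = 4` -/

theorem rank_E2 : twoIsogenySelmerRank 4 5 = 1 := by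
  rw [twoIsogenySelmerRank, selmer_E2]; decide

theorem rank'_E2 : twoIsogenySelmerRank' 4 5 = 1 := by
  rw [twoIsogenySelmerRank', show (-2 * 4 : ℤ) = -8 by norm_num, show ((4 : ℤ) ^ 2 - 4 * 5) = -4 by norm_num,
    twoIsogenySelmerRank, selmer'_E2]; decide

theorem rank_E4 : twoIsogenySelmerRank 8 17 = 1 := by
  rw [twoIsogenySelmerRank, selmer_E4]; decide

theorem rank'_E4 : twoIsogenySelmerRank' 8 17 = 2 := by
  rw [twoIsogenySelmerRank', show (-2 * 8 : ℤ) = -16 by norm_num,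
    show ((8 : ℤ) ^ 2 - 4 * 17) = -4 by norm_num, twoIsogenySelmerRank, selmer'_E4]; decide

/-- Granted Cassels' formula: `corank Sel_{2^∞}(E_2/ℚ)` is EVEN (`s + s' = 1 + 1`). -/
theorem corank_E2_even (hC : cassels_selmerCorank_two_parity) :
    (-1 : ℤ) ^ (WeierstrassCurve.selmerCorank
      (⟨0, 2 * ((2 : ℕ) : ℚ), 0, ((2 : ℕ) : ℚ) ^ 2 + 1, 0⟩ : WeierstrassCurve ℚ) 2) = 1 := by
  have h := hC 4 5 (by norm_num)
  rw [rank_E2, rank'_E2] at h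
  have e : (⟨0, 2 * ((2 : ℕ) : ℚ), 0, ((2 : ℕ) : ℚ) ^ 2 + 1, 0⟩ : WeierstrassCurve ℚ) =
      ⟨0, ((4 : ℤ) : ℚ), 0, ((5 : ℤ) : ℚ), 0⟩ := by norm_num
  rw [e, h]; norm_num

/-- Granted Cassels' formula: `corank Sel_{2^∞}(E_4/ℚ)` is ODD (`s + s' = 1 + 2`). -/
theorem corank_E4_odd (hC : cassels_selmerCorank_two_parity) :
    (-1 : ℤ) ^ (WeierstrassCurve.selmerCorank
      (⟨0, 2 * ((4 : ℕ) : ℚ), 0, ((4 : ℕ) : ℚ) ^ 2 + 1, 0⟩ : WeierstrassCurve ℚ) 2) = -1 := by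
  have h := hC 8 17 (by norm_num)
  rw [rank_E4, rank'_E4] at h
  have e : (⟨0, 2 * ((4 : ℕ) : ℚ), 0, ((4 : ℕ) : ℚ) ^ 2 + 1, 0⟩ : WeierstrassCurve ℚ) =
      ⟨0, ((8 : ℤ) : ℚ), 0, ((17 : ℤ) : ℚ), 0⟩ := by norm_num
  rw [e, h]; norm_num

theorem omegaOdd_E2 : (((2 : ℕ) ^ 2 + 1).primeFactors.filter (fun p : ℕ => p ≠ 2)).card = 1 := by
  rw [show (2 : ℕ) ^ 2 + 1 = 5 by norm_num, Nat.Prime.primeFactors Nat.prime_five]; decide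

theorem omegaOdd_E4 : (((4 : ℕ) ^ 2 + 1).primeFactors.filter (fun p : ℕ => p ≠ 2)).card = 1 := by
  rw [show (4 : ℕ) ^ 2 + 1 = 17 by norm_num, Nat.Prime.primeFactors (by norm_num : Nat.Prime 17)]; decide

/-! ### The same at `t = 1` and `t = 3` (a full residue system modulo 4) -/

theorem not_isSoluble_two_E1_d2 :
    ¬ ((twoIsogenyQuartic (-4) 2 (-2)).map (Int.castRingHom ℚ_[2])).IsSoluble := by
  apply not_isSoluble_padic_of_zmod 2 4 <;> decide

theorem not_isSoluble_two_E1_dneg2 :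
    ¬ ((twoIsogenyQuartic (-4) (-2) 2).map (Int.castRingHom ℚ_[2])).IsSoluble := by
  apply not_isSoluble_padic_of_zmod 2 4 <;> decide

theorem not_isSoluble_two_E3_d2 :
    ¬ ((twoIsogenyQuartic (-12) 2 (-2)).map (Int.castRingHom ℚ_[2])).IsSoluble := by
  apply not_isSoluble_padic_of_zmod 2 5 <;> decide

theorem not_isSoluble_two_E3_dneg2 :
    ¬ ((twoIsogenyQuartic (-12) (-2) 2).map (Int.castRingHom ℚ_[2])).IsSoluble := by
  apply not_isSoluble_padic_of_zmod 2 5 <;> decide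

/-- For `E_3` the classes `2` and `5` of the descent on the divisors of `b = 10` die at `2`. -/
theorem not_isSoluble_two_E3_b_d2 :
    ¬ ((twoIsogenyQuartic 6 2 5).map (Int.castRingHom ℚ_[2])).IsSoluble := by
  apply not_isSoluble_padic_of_zmod 2 4 <;> decide

theorem not_isSoluble_two_E3_b_d5 :
    ¬ ((twoIsogenyQuartic 6 5 2).map (Int.castRingHom ℚ_[2])).IsSoluble := by
  apply not_isSoluble_padic_of_zmod 2 4 <;> decide

/-- Divisors of `10` (as integers). -/
theorem eq_of_dvd_ten {d : ℤ} (hdvd : d ∣ 10) :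
    d = 1 ∨ d = -1 ∨ d = 2 ∨ d = -2 ∨ d = 5 ∨ d = -5 ∨ d = 10 ∨ d = -10 := by
  have hn : d.natAbs ∣ 10 := by
    have := Int.natAbs_dvd_natAbs.mpr hdvd
    simpa using this
  have hmem : d.natAbs ∈ Nat.divisors 10 := Nat.mem_divisors.mpr ⟨hn, by norm_num⟩
  have : Nat.divisors 10 = {1, 2, 5, 10} := by decide
  rw [this] at hmem
  simp only [Finset.mem_insert, Finset.mem_singleton] at hmem
  omega

theorem squarefree_ten : Squarefree (10 : ℤ) := by
  intro x hx
  have h1 : x.natAbs * x.natAbs ∣ 10 := by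
    have := Int.natAbs_dvd_natAbs.mpr hx
    simpa [Int.natAbs_mul] using this
  have h2 : x.natAbs ≤ 10 := Nat.le_of_dvd (by norm_num) (dvd_trans (Dvd.intro _ rfl) h1)
  interval_cases h : x.natAbs <;> first
    | exact Int.isUnit_iff_natAbs_eq.mpr h
    | (exfalso; norm_num at h1)

/-- `S(2, 2) = {1, 2}` (`E_1 : y² = x³ + 2x² + 2x`). -/
theorem selmer_E1 : twoIsogenySelmerGroup 2 2 = {1, 2} := by
  ext d
  rw [mem_twoIsogenySelmerGroup_iff (by norm_num)]
  constructor
  · rintro ⟨hsf, hdvd, hloc⟩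
    rcases eq_of_dvd_prime Nat.prime_two (by exact_mod_cast hdvd) with rfl | rfl | rfl | rfl
    · simp
    · exact absurd hloc.1 (not_isSoluble_real_of_negDef (by norm_num) (by norm_num))
    · simp
    · exact absurd hloc.1 (not_isSoluble_real_of_negDef (by norm_num) (by norm_num))
  · intro hd
    simp only [Finset.mem_insert, Finset.mem_singleton] at hd
    rcases hd with rfl | rfl
    · exact (mem_twoIsogenySelmerGroup_iff (by norm_num)).mp (one_mem_twoIsogenySelmerGroup 2 (by norm_num))
    · exact (mem_twoIsogenySelmerGroup_iff (by norm_num)).mp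
        (self_mem_twoIsogenySelmerGroup 2 squarefree_two)

/-- `S(-4, -4) = {1, -1}` (`E_1`, `a' = -4`). -/
theorem selmer'_E1 : twoIsogenySelmerGroup (-4) (-4) = {1, -1} := by
  ext d
  rw [mem_twoIsogenySelmerGroup_iff (by norm_num)]
  constructor
  · rintro ⟨hsf, hdvd, hloc⟩
    rcases eq_of_squarefree_dvd_neg_four hsf hdvd with rfl | rfl | rfl | rfl
    · simp
    · simp
    · exact absurd (hloc.2 2) (by simpa using not_isSoluble_two_E1_d2)
    · exact absurd (hloc.2 2) (by simpa using not_isSoluble_two_E1_dneg2)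
  · intro hd
    simp only [Finset.mem_insert, Finset.mem_singleton] at hd
    rcases hd with rfl | rfl
    · exact (mem_twoIsogenySelmerGroup_iff (by norm_num)).mp
        (one_mem_twoIsogenySelmerGroup (-4) (by norm_num))
    · exact (mem_twoIsogenySelmerGroup_iff (by norm_num)).mp
        (mem_twoIsogenySelmerGroup_of_isSquare (by norm_num) squarefree_neg_one (by norm_num)
          ⟨2, by norm_num⟩)

/-- `S(6, 10) = {1, 10}` (`E_3 : y² = x³ + 6x² + 10x`): `2, 5` die at `2`, the negatives at `∞`. -/
theorem selmer_E3 : twoIsogenySelmerGroup 6 10 = {1, 10} := by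
  ext d
  rw [mem_twoIsogenySelmerGroup_iff (by norm_num)]
  constructor
  · rintro ⟨hsf, hdvd, hloc⟩
    rcases eq_of_dvd_ten hdvd with rfl | rfl | rfl | rfl | rfl | rfl | rfl | rfl
    · simp
    · exact absurd hloc.1 (not_isSoluble_real_of_negDef (by norm_num) (by norm_num))
    · exact absurd (hloc.2 2) (by simpa using not_isSoluble_two_E3_b_d2)
    · exact absurd hloc.1 (not_isSoluble_real_of_negDef (by norm_num) (by norm_num))
    · exact absurd (hloc.2 2) (by simpa using not_isSoluble_two_E3_b_d5)
    · exact absurd hloc.1 (not_isSoluble_real_of_negDef (by norm_num) (by norm_num))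
    · simp
    · exact absurd hloc.1 (not_isSoluble_real_of_negDef (by norm_num) (by norm_num))
  · intro hd
    simp only [Finset.mem_insert, Finset.mem_singleton] at hd
    rcases hd with rfl | rfl
    · exact (mem_twoIsogenySelmerGroup_iff (by norm_num)).mp (one_mem_twoIsogenySelmerGroup 6 (by norm_num))
    · exact (mem_twoIsogenySelmerGroup_iff (by norm_num)).mp
        (self_mem_twoIsogenySelmerGroup 6 squarefree_ten)

/-- `S(-12, -4) = {1, -1}` (`E_3`, `a' = -12`; obstruction modulo 32). -/
theorem selmer'_E3 : twoIsogenySelmerGroup (-12) (-4) = {1, -1} := by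
  ext d
  rw [mem_twoIsogenySelmerGroup_iff (by norm_num)]
  constructor
  · rintro ⟨hsf, hdvd, hloc⟩
    rcases eq_of_squarefree_dvd_neg_four hsf hdvd with rfl | rfl | rfl | rfl
    · simp
    · simp
    · exact absurd (hloc.2 2) (by simpa using not_isSoluble_two_E3_d2)
    · exact absurd (hloc.2 2) (by simpa using not_isSoluble_two_E3_dneg2)
  · intro hd
    simp only [Finset.mem_insert, Finset.mem_singleton] at hd
    rcases hd with rfl | rfl
    · exact (mem_twoIsogenySelmerGroup_iff (by norm_num)).mp
        (one_mem_twoIsogenySelmerGroup (-12) (by norm_num))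
    · exact (mem_twoIsogenySelmerGroup_iff (by norm_num)).mp
        (mem_twoIsogenySelmerGroup_of_isSquare (by norm_num) squarefree_neg_one (by norm_num)
          ⟨2, by norm_num⟩)

theorem rank_E1 : twoIsogenySelmerRank 2 2 = 1 := by
  rw [twoIsogenySelmerRank, selmer_E1]; decide

theorem rank'_E1 : twoIsogenySelmerRank' 2 2 = 1 := by
  rw [twoIsogenySelmerRank', show (-2 * 2 : ℤ) = -4 by norm_num, show ((2 : ℤ) ^ 2 - 4 * 2) = -4 by norm_num,
    twoIsogenySelmerRank, selmer'_E1]; decide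

theorem rank_E3 : twoIsogenySelmerRank 6 10 = 1 := by
  rw [twoIsogenySelmerRank, selmer_E3]; decide

theorem rank'_E3 : twoIsogenySelmerRank' 6 10 = 1 := by
  rw [twoIsogenySelmerRank', show (-2 * 6 : ℤ) = -12 by norm_num,
    show ((6 : ℤ) ^ 2 - 4 * 10) = -4 by norm_num, twoIsogenySelmerRank, selmer'_E3]; decide

/-- Granted Cassels' formula: `corank Sel_{2^∞}(E_1/ℚ)` is EVEN. -/
theorem corank_E1_even (hC : cassels_selmerCorank_two_parity) :
    (-1 : ℤ) ^ (WeierstrassCurve.selmerCorank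
      (⟨0, 2 * ((1 : ℕ) : ℚ), 0, ((1 : ℕ) : ℚ) ^ 2 + 1, 0⟩ : WeierstrassCurve ℚ) 2) = 1 := by
  have h := hC 2 2 (by norm_num)
  rw [rank_E1, rank'_E1] at h
  have e : (⟨0, 2 * ((1 : ℕ) : ℚ), 0, ((1 : ℕ) : ℚ) ^ 2 + 1, 0⟩ : WeierstrassCurve ℚ) =
      ⟨0, ((2 : ℤ) : ℚ), 0, ((2 : ℤ) : ℚ), 0⟩ := by norm_num
  rw [e, h]; norm_num

/-- Granted Cassels' formula: `corank Sel_{2^∞}(E_3/ℚ)` is EVEN. -/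
theorem corank_E3_even (hC : cassels_selmerCorank_two_parity) :
    (-1 : ℤ) ^ (WeierstrassCurve.selmerCorank
      (⟨0, 2 * ((3 : ℕ) : ℚ), 0, ((3 : ℕ) : ℚ) ^ 2 + 1, 0⟩ : WeierstrassCurve ℚ) 2) = 1 := by
  have h := hC 6 10 (by norm_num)
  rw [rank_E3, rank'_E3] at h
  have e : (⟨0, 2 * ((3 : ℕ) : ℚ), 0, ((3 : ℕ) : ℚ) ^ 2 + 1, 0⟩ : WeierstrassCurve ℚ) =
      ⟨0, ((6 : ℤ) : ℚ), 0, ((10 : ℤ) : ℚ), 0⟩ := by norm_num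
  rw [e, h]; norm_num

theorem omegaOdd_E1 : (((1 : ℕ) ^ 2 + 1).primeFactors.filter (fun p : ℕ => p ≠ 2)).card = 0 := by
  rw [show (1 : ℕ) ^ 2 + 1 = 2 by norm_num, Nat.Prime.primeFactors Nat.prime_two]; decide

theorem omegaOdd_E3 : (((3 : ℕ) ^ 2 + 1).primeFactors.filter (fun p : ℕ => p ≠ 2)).card = 1 := by
  rw [show (3 : ℕ) ^ 2 + 1 = 2 * 5 by norm_num, Nat.primeFactors_mul (by norm_num) (by norm_num),
    Nat.Prime.primeFactors Nat.prime_two, Nat.Prime.primeFactors Nat.prime_five]; decide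

/-! ### TIGHTNESS: the crux is false with `M ≤ 1` (granted Cassels' formula) -/

/-- The crux with a prescribed exponent `M`. -/
def PencilSelmerDictionaryWith (M : ℕ) : Prop :=
  ∃ w : ℕ → ℤ, (∀ t : ℕ, w (t + 2 ^ M) = w t) ∧ ∀ t : ℕ, 1 ≤ t →
    (-1 : ℤ) ^ (WeierstrassCurve.selmerCorank (⟨0, 2 * (t : ℚ), 0, (t : ℚ) ^ 2 + 1, 0⟩ :
      WeierstrassCurve ℚ) 2) =
      -(w t * (-1 : ℤ) ^ (((t ^ 2 + 1).primeFactors.filter (fun p : ℕ => p ≠ 2)).card))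

theorem pencilSelmerDictionary_iff_exists_with :
    PencilSelmerDictionary ↔ ∃ M, PencilSelmerDictionaryWith M := Iff.rfl

/-- **TIGHTNESS.** Granted the tree's named fact `cassels_selmerCorank_two_parity` (Cassels' formula
for the `2`-isogeny in parity form), the crux FAILS with period `2` (`M = 1`): the Selmer-side sign
`(-1)^{corank + ω_odd}` is `-1` at `t = 2` and `+1` at `t = 4` (explicit descents: `S(4,5) = {1,5}`,
`S(-8,-4) = {±1}` — the classes `±2` are obstructed modulo `16` —, `S(8,17) = {1,17}`,
`S(-16,-4) = {±1, ±2}` with the global points `4² = 2·3⁴ - 16·3² - 2`). So the least admissible `M`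
is `≥ 2`; the crux ideator's table (card `cassels-local-images-mod4`, job j004946, t ≤ 4000) says `M = 2`
works with `w = (-1, -1, +1, +1)` on `t mod 4`. -/
theorem not_pencilSelmerDictionaryWith_one (hC : cassels_selmerCorank_two_parity) :
    ¬ PencilSelmerDictionaryWith 1 := by
  rintro ⟨w, hw, h⟩
  have h2 := h 2 (by norm_num)
  have h4 := h 4 (by norm_num)
  rw [corank_E2_even hC, omegaOdd_E2] at h2
  rw [corank_E4_odd hC, omegaOdd_E4] at h4
  have hw4 : w 4 = w 2 := by
    have := hw 2
    norm_num at this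
    exact this
  rw [hw4] at h4
  simp only [pow_one, mul_neg, mul_one, neg_neg] at h2 h4
  omega

/-- Hence also not with `M = 0` (a `1`-periodic `w` is `2`-periodic). -/
theorem not_pencilSelmerDictionaryWith_zero (hC : cassels_selmerCorank_two_parity) :
    ¬ PencilSelmerDictionaryWith 0 := by
  rintro ⟨w, hw, h⟩
  refine not_pencilSelmerDictionaryWith_one hC ⟨w, fun t => ?_, h⟩
  have h1 := hw t
  have h2 := hw (t + 1)
  simp only [pow_zero] at h1 h2
  rw [show t + 2 ^ 1 = t + 1 + 1 by norm_num, h2, h1]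


/-! ### The forced values of `w` on a residue system mod 4 (granted Cassels) -/

/-- Granted Cassels' formula, ANY witness `(M, w)` of the crux satisfies
`(w 1, w 2, w 3, w 4) = (-1, +1, +1, -1)` — the crux ideator's table `w = (-1, -1, +1, +1)` on
`t mod 4 = (0, 1, 2, 3)` (card `cassels-local-images-mod4`), now Lean-certified on `1 ≤ t ≤ 4` from four
explicit `2`-isogeny descents; in root-number currency (`w t = W₂(E_t)` under 2-parity and the split-fibre
analysis): `W₂(E_1) = -1, W₂(E_2) = +1, W₂(E_3) = +1, W₂(E_4) = -1`. -/
theorem forced_w_values (hC : cassels_selmerCorank_two_parity) {w : ℕ → ℤ}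
    (h : ∀ t : ℕ, 1 ≤ t →
      (-1 : ℤ) ^ (WeierstrassCurve.selmerCorank (⟨0, 2 * (t : ℚ), 0, (t : ℚ) ^ 2 + 1, 0⟩ :
        WeierstrassCurve ℚ) 2) =
        -(w t * (-1 : ℤ) ^ (((t ^ 2 + 1).primeFactors.filter (fun p : ℕ => p ≠ 2)).card))) :
    w 1 = -1 ∧ w 2 = 1 ∧ w 3 = 1 ∧ w 4 = -1 := by
  have h1 := h 1 le_rfl
  have h2 := h 2 (by norm_num)
  have h3 := h 3 (by norm_num)
  have h4 := h 4 (by norm_num)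
  rw [corank_E1_even hC, omegaOdd_E1] at h1
  rw [corank_E2_even hC, omegaOdd_E2] at h2
  rw [corank_E3_even hC, omegaOdd_E3] at h3
  rw [corank_E4_odd hC, omegaOdd_E4] at h4
  simp only [pow_one, pow_zero, mul_neg, mul_one, neg_neg] at h1 h2 h3 h4
  omega

/-- The conjectured sharp table (period `4`): `w(t) = -1` for `t ≡ 0, 1 (mod 4)`, `+1` for
`t ≡ 2, 3 (mod 4)`; equivalently `corank Sel_{2^∞}(E_t) ≡ ⌊t/2⌋ + ω_odd(t²+1) (mod 2)`. -/
def wTable (r : ℕ) : ℤ := if r % 4 < 2 then -1 else 1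

/-- The sharp table is the right one on `1 ≤ t ≤ 4`, granted Cassels' formula. -/
theorem sharp_table_holds_upto_four (hC : cassels_selmerCorank_two_parity) (t : ℕ) (ht : 1 ≤ t)
    (ht4 : t ≤ 4) :
    (-1 : ℤ) ^ (WeierstrassCurve.selmerCorank (⟨0, 2 * (t : ℚ), 0, (t : ℚ) ^ 2 + 1, 0⟩ :
        WeierstrassCurve ℚ) 2) =
      -(wTable (t % 2 ^ 2) * (-1 : ℤ) ^ (((t ^ 2 + 1).primeFactors.filter (fun p : ℕ => p ≠ 2)).card)) := by
  interval_cases t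
  · rw [corank_E1_even hC, omegaOdd_E1]; decide
  · rw [corank_E2_even hC, omegaOdd_E2]; decide
  · rw [corank_E3_even hC, omegaOdd_E3]; decide
  · rw [corank_E4_odd hC, omegaOdd_E4]; decide


/-! ### Two full periods: `t = 5, 6, 7, 8` -/

instance fact_prime_five : Fact (Nat.Prime 5) := ⟨Nat.prime_five⟩

/-- A decidable squarefreeness test for integer literals. -/
theorem squarefree_int_of_forall {n : ℤ} (hn : n ≠ 0)
    (h : ∀ x : ℕ, x ≤ n.natAbs → x * x ∣ n.natAbs → x = 1) : Squarefree n := by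
  intro x hx
  have h1 : x.natAbs * x.natAbs ∣ n.natAbs := by
    have := Int.natAbs_dvd_natAbs.mpr hx
    simpa [Int.natAbs_mul] using this
  have h2 : x.natAbs ≤ n.natAbs :=
    Nat.le_of_dvd (Int.natAbs_pos.mpr hn) (dvd_trans (Dvd.intro _ rfl) h1)
  exact Int.isUnit_iff_natAbs_eq.mpr (h _ h2 h1)

theorem squarefree_26 : Squarefree (26 : ℤ) := squarefree_int_of_forall (by norm_num) (by decide)
theorem squarefree_13 : Squarefree (13 : ℤ) := squarefree_int_of_forall (by norm_num) (by decide)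
theorem squarefree_37 : Squarefree (37 : ℤ) := squarefree_int_of_forall (by norm_num) (by decide)
theorem squarefree_65 : Squarefree (65 : ℤ) := squarefree_int_of_forall (by norm_num) (by decide)
theorem not_squarefree_25 : ¬ Squarefree (25 : ℤ) := fun h => by
  have h5 : IsUnit (5 : ℤ) := h 5 ⟨1, by norm_num⟩
  rcases Int.isUnit_iff.mp h5 with h' | h' <;> omega
theorem not_squarefree_neg_25 : ¬ Squarefree (-25 : ℤ) := fun h => by
  have h5 : IsUnit (5 : ℤ) := h 5 ⟨-1, by norm_num⟩
  rcases Int.isUnit_iff.mp h5 with h' | h' <;> omega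
theorem not_squarefree_50 : ¬ Squarefree (50 : ℤ) := fun h => by
  have h5 : IsUnit (5 : ℤ) := h 5 ⟨2, by norm_num⟩
  rcases Int.isUnit_iff.mp h5 with h' | h' <;> omega
theorem not_squarefree_neg_50 : ¬ Squarefree (-50 : ℤ) := fun h => by
  have h5 : IsUnit (5 : ℤ) := h 5 ⟨-2, by norm_num⟩
  rcases Int.isUnit_iff.mp h5 with h' | h' <;> omega

theorem eq_of_dvd_26 {d : ℤ} (hdvd : d ∣ 26) :
    d = 1 ∨ d = -1 ∨ d = 2 ∨ d = -2 ∨ d = 13 ∨ d = -13 ∨ d = 26 ∨ d = -26 := by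
  have hn : d.natAbs ∣ 26 := by
    have := Int.natAbs_dvd_natAbs.mpr hdvd
    simpa using this
  have hmem : d.natAbs ∈ Nat.divisors 26 := Nat.mem_divisors.mpr ⟨hn, by norm_num⟩
  have : Nat.divisors 26 = {1, 2, 13, 26} := by decide
  rw [this] at hmem
  simp only [Finset.mem_insert, Finset.mem_singleton] at hmem
  omega

theorem eq_of_squarefree_dvd_50 {d : ℤ} (hsf : Squarefree d) (hdvd : d ∣ 50) :
    d = 1 ∨ d = -1 ∨ d = 2 ∨ d = -2 ∨ d = 5 ∨ d = -5 ∨ d = 10 ∨ d = -10 := by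
  have hn : d.natAbs ∣ 50 := by
    have := Int.natAbs_dvd_natAbs.mpr hdvd
    simpa using this
  have hmem : d.natAbs ∈ Nat.divisors 50 := Nat.mem_divisors.mpr ⟨hn, by norm_num⟩
  have : Nat.divisors 50 = {1, 2, 5, 10, 25, 50} := by decide
  rw [this] at hmem
  simp only [Finset.mem_insert, Finset.mem_singleton] at hmem
  have h25 : d ≠ 25 := fun h => not_squarefree_25 (h ▸ hsf)
  have h25' : d ≠ -25 := fun h => not_squarefree_neg_25 (h ▸ hsf)
  have h50 : d ≠ 50 := fun h => not_squarefree_50 (h ▸ hsf)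
  have h50' : d ≠ -50 := fun h => not_squarefree_neg_50 (h ▸ hsf)
  omega

theorem eq_of_dvd_65 {d : ℤ} (hdvd : d ∣ 65) :
    d = 1 ∨ d = -1 ∨ d = 5 ∨ d = -5 ∨ d = 13 ∨ d = -13 ∨ d = 65 ∨ d = -65 := by
  have hn : d.natAbs ∣ 65 := by
    have := Int.natAbs_dvd_natAbs.mpr hdvd
    simpa using this
  have hmem : d.natAbs ∈ Nat.divisors 65 := Nat.mem_divisors.mpr ⟨hn, by norm_num⟩
  have : Nat.divisors 65 = {1, 5, 13, 65} := by decide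
  rw [this] at hmem
  simp only [Finset.mem_insert, Finset.mem_singleton] at hmem
  omega

-- 2-adic and 5-adic obstructions
theorem not_isSoluble_two_E5_d2 :
    ¬ ((twoIsogenyQuartic (-20) 2 (-2)).map (Int.castRingHom ℚ_[2])).IsSoluble := by
  apply not_isSoluble_padic_of_zmod 2 4 <;> decide
theorem not_isSoluble_two_E5_dneg2 :
    ¬ ((twoIsogenyQuartic (-20) (-2) 2).map (Int.castRingHom ℚ_[2])).IsSoluble := by
  apply not_isSoluble_padic_of_zmod 2 4 <;> decide
theorem not_isSoluble_two_E6_d2 :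
    ¬ ((twoIsogenyQuartic (-24) 2 (-2)).map (Int.castRingHom ℚ_[2])).IsSoluble := by
  apply not_isSoluble_padic_of_zmod 2 4 <;> decide
theorem not_isSoluble_two_E6_dneg2 :
    ¬ ((twoIsogenyQuartic (-24) (-2) 2).map (Int.castRingHom ℚ_[2])).IsSoluble := by
  apply not_isSoluble_padic_of_zmod 2 4 <;> decide
/-- At `t = 7` and `t = 8` the classes `±2` of `S(-4t, -4)` pass modulo powers of `2` but die at
`p = 5 ∣ t² + 1` (`5 ≡ 5 (mod 8)`: `2` and `t` are non-residues). -/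
theorem not_isSoluble_five_E7_d2 :
    ¬ ((twoIsogenyQuartic (-28) 2 (-2)).map (Int.castRingHom ℚ_[5])).IsSoluble := by
  apply not_isSoluble_padic_of_zmod 5 1 <;> decide
theorem not_isSoluble_five_E7_dneg2 :
    ¬ ((twoIsogenyQuartic (-28) (-2) 2).map (Int.castRingHom ℚ_[5])).IsSoluble := by
  apply not_isSoluble_padic_of_zmod 5 1 <;> decide
theorem not_isSoluble_five_E8_d2 :
    ¬ ((twoIsogenyQuartic (-32) 2 (-2)).map (Int.castRingHom ℚ_[5])).IsSoluble := by
  apply not_isSoluble_padic_of_zmod 5 1 <;> decide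
theorem not_isSoluble_five_E8_dneg2 :
    ¬ ((twoIsogenyQuartic (-32) (-2) 2).map (Int.castRingHom ℚ_[5])).IsSoluble := by
  apply not_isSoluble_padic_of_zmod 5 1 <;> decide
theorem not_isSoluble_two_E7_b_d5 :
    ¬ ((twoIsogenyQuartic 14 5 10).map (Int.castRingHom ℚ_[2])).IsSoluble := by
  apply not_isSoluble_padic_of_zmod 2 4 <;> decide
theorem not_isSoluble_two_E7_b_d10 :
    ¬ ((twoIsogenyQuartic 14 10 5).map (Int.castRingHom ℚ_[2])).IsSoluble := by
  apply not_isSoluble_padic_of_zmod 2 4 <;> decide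
theorem not_isSoluble_two_E8_b_d5 :
    ¬ ((twoIsogenyQuartic 16 5 13).map (Int.castRingHom ℚ_[2])).IsSoluble := by
  apply not_isSoluble_padic_of_zmod 2 4 <;> decide
theorem not_isSoluble_two_E8_b_d13 :
    ¬ ((twoIsogenyQuartic 16 13 5).map (Int.castRingHom ℚ_[2])).IsSoluble := by
  apply not_isSoluble_padic_of_zmod 2 4 <;> decide

/-- `S(10, 26) = {1, 2, 13, 26}` (`E_5`; `2, 13` are GLOBAL: `5² = 2 + 10 + 13`, the point `(2, 10)` on
`E_5`, of infinite order). -/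
theorem selmer_E5 : twoIsogenySelmerGroup 10 26 = {1, 2, 13, 26} := by
  ext d
  rw [mem_twoIsogenySelmerGroup_iff (by norm_num)]
  constructor
  · rintro ⟨hsf, hdvd, hloc⟩
    rcases eq_of_dvd_26 hdvd with rfl | rfl | rfl | rfl | rfl | rfl | rfl | rfl
    · simp
    · exact absurd hloc.1 (not_isSoluble_real_of_negDef (by norm_num) (by norm_num))
    · simp
    · exact absurd hloc.1 (not_isSoluble_real_of_negDef (by norm_num) (by norm_num))
    · simp
    · exact absurd hloc.1 (not_isSoluble_real_of_negDef (by norm_num) (by norm_num))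
    · simp
    · exact absurd hloc.1 (not_isSoluble_real_of_negDef (by norm_num) (by norm_num))
  · intro hd
    simp only [Finset.mem_insert, Finset.mem_singleton] at hd
    rcases hd with rfl | rfl | rfl | rfl
    · exact (mem_twoIsogenySelmerGroup_iff (by norm_num)).mp (one_mem_twoIsogenySelmerGroup 10 (by norm_num))
    · refine ⟨squarefree_two, by norm_num, ?_⟩
      exact isLocallySoluble_of_int_point _ (x := 1) (y := 1) (z := 5) (Or.inl (by norm_num))
        (by norm_num [twoIsogenyQuartic, BinaryQuartic.eval])
    · refine ⟨squarefree_13, by norm_num, ?_⟩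
      exact isLocallySoluble_of_int_point _ (x := 1) (y := 1) (z := 5) (Or.inl (by norm_num))
        (by norm_num [twoIsogenyQuartic, BinaryQuartic.eval])
    · exact (mem_twoIsogenySelmerGroup_iff (by norm_num)).mp
        (self_mem_twoIsogenySelmerGroup 10 squarefree_26)

theorem selmer'_E5 : twoIsogenySelmerGroup (-20) (-4) = {1, -1} := by
  ext d
  rw [mem_twoIsogenySelmerGroup_iff (by norm_num)]
  constructor
  · rintro ⟨hsf, hdvd, hloc⟩
    rcases eq_of_squarefree_dvd_neg_four hsf hdvd with rfl | rfl | rfl | rfl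
    · simp
    · simp
    · exact absurd (hloc.2 2) (by simpa using not_isSoluble_two_E5_d2)
    · exact absurd (hloc.2 2) (by simpa using not_isSoluble_two_E5_dneg2)
  · intro hd
    simp only [Finset.mem_insert, Finset.mem_singleton] at hd
    rcases hd with rfl | rfl
    · exact (mem_twoIsogenySelmerGroup_iff (by norm_num)).mp
        (one_mem_twoIsogenySelmerGroup (-20) (by norm_num))
    · exact (mem_twoIsogenySelmerGroup_iff (by norm_num)).mp
        (mem_twoIsogenySelmerGroup_of_isSquare (by norm_num) squarefree_neg_one (by norm_num)
          ⟨2, by norm_num⟩)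

theorem selmer_E6 : twoIsogenySelmerGroup 12 37 = {1, 37} := by
  ext d
  rw [mem_twoIsogenySelmerGroup_iff (by norm_num)]
  constructor
  · rintro ⟨hsf, hdvd, hloc⟩
    rcases eq_of_dvd_prime (by norm_num : Nat.Prime 37) (by exact_mod_cast hdvd) with
      rfl | rfl | rfl | rfl
    · simp
    · exact absurd hloc.1 (not_isSoluble_real_of_negDef (by norm_num) (by norm_num))
    · simp
    · exact absurd hloc.1 (not_isSoluble_real_of_negDef (by norm_num) (by norm_num))
  · intro hd
    simp only [Finset.mem_insert, Finset.mem_singleton] at hd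
    rcases hd with rfl | rfl
    · exact (mem_twoIsogenySelmerGroup_iff (by norm_num)).mp (one_mem_twoIsogenySelmerGroup 12 (by norm_num))
    · exact (mem_twoIsogenySelmerGroup_iff (by norm_num)).mp
        (self_mem_twoIsogenySelmerGroup 12 squarefree_37)

theorem selmer'_E6 : twoIsogenySelmerGroup (-24) (-4) = {1, -1} := by
  ext d
  rw [mem_twoIsogenySelmerGroup_iff (by norm_num)]
  constructor
  · rintro ⟨hsf, hdvd, hloc⟩
    rcases eq_of_squarefree_dvd_neg_four hsf hdvd with rfl | rfl | rfl | rfl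
    · simp
    · simp
    · exact absurd (hloc.2 2) (by simpa using not_isSoluble_two_E6_d2)
    · exact absurd (hloc.2 2) (by simpa using not_isSoluble_two_E6_dneg2)
  · intro hd
    simp only [Finset.mem_insert, Finset.mem_singleton] at hd
    rcases hd with rfl | rfl
    · exact (mem_twoIsogenySelmerGroup_iff (by norm_num)).mp
        (one_mem_twoIsogenySelmerGroup (-24) (by norm_num))
    · exact (mem_twoIsogenySelmerGroup_iff (by norm_num)).mp
        (mem_twoIsogenySelmerGroup_of_isSquare (by norm_num) squarefree_neg_one (by norm_num)
          ⟨2, by norm_num⟩)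

/-- `S(14, 50) = {1, 2}` (`E_7`; `b = 50 = 2·5²`, so `2 ≡ b` is the image of `(0,0)`; `5, 10` die at `2`). -/
theorem selmer_E7 : twoIsogenySelmerGroup 14 50 = {1, 2} := by
  ext d
  rw [mem_twoIsogenySelmerGroup_iff (by norm_num)]
  constructor
  · rintro ⟨hsf, hdvd, hloc⟩
    rcases eq_of_squarefree_dvd_50 hsf hdvd with rfl | rfl | rfl | rfl | rfl | rfl | rfl | rfl
    · simp
    · exact absurd hloc.1 (not_isSoluble_real_of_negDef (by norm_num) (by norm_num))
    · simp
    · exact absurd hloc.1 (not_isSoluble_real_of_negDef (by norm_num) (by norm_num))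
    · exact absurd (hloc.2 2) (by simpa using not_isSoluble_two_E7_b_d5)
    · exact absurd hloc.1 (not_isSoluble_real_of_negDef (by norm_num) (by norm_num))
    · exact absurd (hloc.2 2) (by simpa using not_isSoluble_two_E7_b_d10)
    · exact absurd hloc.1 (not_isSoluble_real_of_negDef (by norm_num) (by norm_num))
  · intro hd
    simp only [Finset.mem_insert, Finset.mem_singleton] at hd
    rcases hd with rfl | rfl
    · exact (mem_twoIsogenySelmerGroup_iff (by norm_num)).mp (one_mem_twoIsogenySelmerGroup 14 (by norm_num))
    · exact (mem_twoIsogenySelmerGroup_iff (by norm_num)).mp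
        (mem_twoIsogenySelmerGroup_of_isSquare (by norm_num) squarefree_two (by norm_num) ⟨5, by norm_num⟩)

theorem selmer'_E7 : twoIsogenySelmerGroup (-28) (-4) = {1, -1} := by
  ext d
  rw [mem_twoIsogenySelmerGroup_iff (by norm_num)]
  constructor
  · rintro ⟨hsf, hdvd, hloc⟩
    rcases eq_of_squarefree_dvd_neg_four hsf hdvd with rfl | rfl | rfl | rfl
    · simp
    · simp
    · exact absurd (hloc.2 5) (by simpa using not_isSoluble_five_E7_d2)
    · exact absurd (hloc.2 5) (by simpa using not_isSoluble_five_E7_dneg2)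
  · intro hd
    simp only [Finset.mem_insert, Finset.mem_singleton] at hd
    rcases hd with rfl | rfl
    · exact (mem_twoIsogenySelmerGroup_iff (by norm_num)).mp
        (one_mem_twoIsogenySelmerGroup (-28) (by norm_num))
    · exact (mem_twoIsogenySelmerGroup_iff (by norm_num)).mp
        (mem_twoIsogenySelmerGroup_of_isSquare (by norm_num) squarefree_neg_one (by norm_num)
          ⟨2, by norm_num⟩)

/-- `S(16, 65) = {1, 65}` (`E_8`; `5, 13` die at `2`). -/
theorem selmer_E8 : twoIsogenySelmerGroup 16 65 = {1, 65} := by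
  ext d
  rw [mem_twoIsogenySelmerGroup_iff (by norm_num)]
  constructor
  · rintro ⟨hsf, hdvd, hloc⟩
    rcases eq_of_dvd_65 hdvd with rfl | rfl | rfl | rfl | rfl | rfl | rfl | rfl
    · simp
    · exact absurd hloc.1 (not_isSoluble_real_of_negDef (by norm_num) (by norm_num))
    · exact absurd (hloc.2 2) (by simpa using not_isSoluble_two_E8_b_d5)
    · exact absurd hloc.1 (not_isSoluble_real_of_negDef (by norm_num) (by norm_num))
    · exact absurd (hloc.2 2) (by simpa using not_isSoluble_two_E8_b_d13)
    · exact absurd hloc.1 (not_isSoluble_real_of_negDef (by norm_num) (by norm_num))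
    · simp
    · exact absurd hloc.1 (not_isSoluble_real_of_negDef (by norm_num) (by norm_num))
  · intro hd
    simp only [Finset.mem_insert, Finset.mem_singleton] at hd
    rcases hd with rfl | rfl
    · exact (mem_twoIsogenySelmerGroup_iff (by norm_num)).mp (one_mem_twoIsogenySelmerGroup 16 (by norm_num))
    · exact (mem_twoIsogenySelmerGroup_iff (by norm_num)).mp
        (self_mem_twoIsogenySelmerGroup 16 squarefree_65)

theorem selmer'_E8 : twoIsogenySelmerGroup (-32) (-4) = {1, -1} := by
  ext d
  rw [mem_twoIsogenySelmerGroup_iff (by norm_num)]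
  constructor
  · rintro ⟨hsf, hdvd, hloc⟩
    rcases eq_of_squarefree_dvd_neg_four hsf hdvd with rfl | rfl | rfl | rfl
    · simp
    · simp
    · exact absurd (hloc.2 5) (by simpa using not_isSoluble_five_E8_d2)
    · exact absurd (hloc.2 5) (by simpa using not_isSoluble_five_E8_dneg2)
  · intro hd
    simp only [Finset.mem_insert, Finset.mem_singleton] at hd
    rcases hd with rfl | rfl
    · exact (mem_twoIsogenySelmerGroup_iff (by norm_num)).mp
        (one_mem_twoIsogenySelmerGroup (-32) (by norm_num))
    · exact (mem_twoIsogenySelmerGroup_iff (by norm_num)).mp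
        (mem_twoIsogenySelmerGroup_of_isSquare (by norm_num) squarefree_neg_one (by norm_num)
          ⟨2, by norm_num⟩)

theorem rank_E5 : twoIsogenySelmerRank 10 26 = 2 := by
  rw [twoIsogenySelmerRank, selmer_E5]; decide
theorem rank'_E5 : twoIsogenySelmerRank' 10 26 = 1 := by
  rw [twoIsogenySelmerRank', show (-2 * 10 : ℤ) = -20 by norm_num,
    show ((10 : ℤ) ^ 2 - 4 * 26) = -4 by norm_num, twoIsogenySelmerRank, selmer'_E5]; decide
theorem rank_E6 : twoIsogenySelmerRank 12 37 = 1 := by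
  rw [twoIsogenySelmerRank, selmer_E6]; decide
theorem rank'_E6 : twoIsogenySelmerRank' 12 37 = 1 := by
  rw [twoIsogenySelmerRank', show (-2 * 12 : ℤ) = -24 by norm_num,
    show ((12 : ℤ) ^ 2 - 4 * 37) = -4 by norm_num, twoIsogenySelmerRank, selmer'_E6]; decide
theorem rank_E7 : twoIsogenySelmerRank 14 50 = 1 := by
  rw [twoIsogenySelmerRank, selmer_E7]; decide
theorem rank'_E7 : twoIsogenySelmerRank' 14 50 = 1 := by
  rw [twoIsogenySelmerRank', show (-2 * 14 : ℤ) = -28 by norm_num,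
    show ((14 : ℤ) ^ 2 - 4 * 50) = -4 by norm_num, twoIsogenySelmerRank, selmer'_E7]; decide
theorem rank_E8 : twoIsogenySelmerRank 16 65 = 1 := by
  rw [twoIsogenySelmerRank, selmer_E8]; decide
theorem rank'_E8 : twoIsogenySelmerRank' 16 65 = 1 := by
  rw [twoIsogenySelmerRank', show (-2 * 16 : ℤ) = -32 by norm_num,
    show ((16 : ℤ) ^ 2 - 4 * 65) = -4 by norm_num, twoIsogenySelmerRank, selmer'_E8]; decide

theorem corank_E5_odd (hC : cassels_selmerCorank_two_parity) :
    (-1 : ℤ) ^ (WeierstrassCurve.selmerCorank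
      (⟨0, 2 * ((5 : ℕ) : ℚ), 0, ((5 : ℕ) : ℚ) ^ 2 + 1, 0⟩ : WeierstrassCurve ℚ) 2) = -1 := by
  have h := hC 10 26 (by norm_num)
  rw [rank_E5, rank'_E5] at h
  have e : (⟨0, 2 * ((5 : ℕ) : ℚ), 0, ((5 : ℕ) : ℚ) ^ 2 + 1, 0⟩ : WeierstrassCurve ℚ) =
      ⟨0, ((10 : ℤ) : ℚ), 0, ((26 : ℤ) : ℚ), 0⟩ := by norm_num
  rw [e, h]; norm_num

theorem corank_E6_even (hC : cassels_selmerCorank_two_parity) :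
    (-1 : ℤ) ^ (WeierstrassCurve.selmerCorank
      (⟨0, 2 * ((6 : ℕ) : ℚ), 0, ((6 : ℕ) : ℚ) ^ 2 + 1, 0⟩ : WeierstrassCurve ℚ) 2) = 1 := by
  have h := hC 12 37 (by norm_num)
  rw [rank_E6, rank'_E6] at h
  have e : (⟨0, 2 * ((6 : ℕ) : ℚ), 0, ((6 : ℕ) : ℚ) ^ 2 + 1, 0⟩ : WeierstrassCurve ℚ) =
      ⟨0, ((12 : ℤ) : ℚ), 0, ((37 : ℤ) : ℚ), 0⟩ := by norm_num
  rw [e, h]; norm_num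

theorem corank_E7_even (hC : cassels_selmerCorank_two_parity) :
    (-1 : ℤ) ^ (WeierstrassCurve.selmerCorank
      (⟨0, 2 * ((7 : ℕ) : ℚ), 0, ((7 : ℕ) : ℚ) ^ 2 + 1, 0⟩ : WeierstrassCurve ℚ) 2) = 1 := by
  have h := hC 14 50 (by norm_num)
  rw [rank_E7, rank'_E7] at h
  have e : (⟨0, 2 * ((7 : ℕ) : ℚ), 0, ((7 : ℕ) : ℚ) ^ 2 + 1, 0⟩ : WeierstrassCurve ℚ) =
      ⟨0, ((14 : ℤ) : ℚ), 0, ((50 : ℤ) : ℚ), 0⟩ := by norm_num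
  rw [e, h]; norm_num

theorem corank_E8_even (hC : cassels_selmerCorank_two_parity) :
    (-1 : ℤ) ^ (WeierstrassCurve.selmerCorank
      (⟨0, 2 * ((8 : ℕ) : ℚ), 0, ((8 : ℕ) : ℚ) ^ 2 + 1, 0⟩ : WeierstrassCurve ℚ) 2) = 1 := by
  have h := hC 16 65 (by norm_num)
  rw [rank_E8, rank'_E8] at h
  have e : (⟨0, 2 * ((8 : ℕ) : ℚ), 0, ((8 : ℕ) : ℚ) ^ 2 + 1, 0⟩ : WeierstrassCurve ℚ) =
      ⟨0, ((16 : ℤ) : ℚ), 0, ((65 : ℤ) : ℚ), 0⟩ := by norm_num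
  rw [e, h]; norm_num

theorem omegaOdd_E5 : (((5 : ℕ) ^ 2 + 1).primeFactors.filter (fun p : ℕ => p ≠ 2)).card = 1 := by
  rw [show (5 : ℕ) ^ 2 + 1 = 2 * 13 by norm_num, Nat.primeFactors_mul (by norm_num) (by norm_num),
    Nat.Prime.primeFactors Nat.prime_two, Nat.Prime.primeFactors (by norm_num : Nat.Prime 13)]; decide
theorem omegaOdd_E6 : (((6 : ℕ) ^ 2 + 1).primeFactors.filter (fun p : ℕ => p ≠ 2)).card = 1 := by
  rw [show (6 : ℕ) ^ 2 + 1 = 37 by norm_num, Nat.Prime.primeFactors (by norm_num : Nat.Prime 37)]; decide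
theorem omegaOdd_E7 : (((7 : ℕ) ^ 2 + 1).primeFactors.filter (fun p : ℕ => p ≠ 2)).card = 1 := by
  rw [show (7 : ℕ) ^ 2 + 1 = 2 * 5 ^ 2 by norm_num, Nat.primeFactors_mul (by norm_num) (by norm_num),
    Nat.primeFactors_pow _ (by norm_num), Nat.Prime.primeFactors Nat.prime_two,
    Nat.Prime.primeFactors Nat.prime_five]; decide
theorem omegaOdd_E8 : (((8 : ℕ) ^ 2 + 1).primeFactors.filter (fun p : ℕ => p ≠ 2)).card = 2 := by
  rw [show (8 : ℕ) ^ 2 + 1 = 5 * 13 by norm_num, Nat.primeFactors_mul (by norm_num) (by norm_num),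
    Nat.Prime.primeFactors Nat.prime_five, Nat.Prime.primeFactors (by norm_num : Nat.Prime 13)]; decide

/-- Granted Cassels' formula, any witness `(M, w)` of the crux has
`(w 1, …, w 8) = (-1, 1, 1, -1, -1, 1, 1, -1)` — TWO full periods of the table `(-1, -1, +1, +1)` on
`t mod 4 = (0, 1, 2, 3)`. -/
theorem forced_w_values_upto_eight (hC : cassels_selmerCorank_two_parity) {w : ℕ → ℤ}
    (h : ∀ t : ℕ, 1 ≤ t →
      (-1 : ℤ) ^ (WeierstrassCurve.selmerCorank (⟨0, 2 * (t : ℚ), 0, (t : ℚ) ^ 2 + 1, 0⟩ :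
        WeierstrassCurve ℚ) 2) =
        -(w t * (-1 : ℤ) ^ (((t ^ 2 + 1).primeFactors.filter (fun p : ℕ => p ≠ 2)).card))) :
    w 1 = -1 ∧ w 2 = 1 ∧ w 3 = 1 ∧ w 4 = -1 ∧ w 5 = -1 ∧ w 6 = 1 ∧ w 7 = 1 ∧ w 8 = -1 := by
  obtain ⟨e1, e2, e3, e4⟩ := forced_w_values hC h
  have h5 := h 5 (by norm_num)
  have h6 := h 6 (by norm_num)
  have h7 := h 7 (by norm_num)
  have h8 := h 8 (by norm_num)
  rw [corank_E5_odd hC, omegaOdd_E5] at h5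
  rw [corank_E6_even hC, omegaOdd_E6] at h6
  rw [corank_E7_even hC, omegaOdd_E7] at h7
  rw [corank_E8_even hC, omegaOdd_E8] at h8
  simp only [pow_one, mul_neg, mul_one, neg_neg] at h5 h6 h7 h8
  have h8' : w 8 = -1 := by
    have : ((-1 : ℤ)) ^ 2 = 1 := by norm_num
    rw [this, mul_one] at h8
    linarith
  omega

/-- The sharp table holds on `1 ≤ t ≤ 8`, granted Cassels' formula. -/
theorem sharp_table_holds_upto_eight (hC : cassels_selmerCorank_two_parity) (t : ℕ) (ht : 1 ≤ t)
    (ht8 : t ≤ 8) :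
    (-1 : ℤ) ^ (WeierstrassCurve.selmerCorank (⟨0, 2 * (t : ℚ), 0, (t : ℚ) ^ 2 + 1, 0⟩ :
        WeierstrassCurve ℚ) 2) =
      -(wTable (t % 2 ^ 2) * (-1 : ℤ) ^ (((t ^ 2 + 1).primeFactors.filter (fun p : ℕ => p ≠ 2)).card)) := by
  interval_cases t
  · rw [corank_E1_even hC, omegaOdd_E1]; decide
  · rw [corank_E2_even hC, omegaOdd_E2]; decide
  · rw [corank_E3_even hC, omegaOdd_E3]; decide
  · rw [corank_E4_odd hC, omegaOdd_E4]; decide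
  · rw [corank_E5_odd hC, omegaOdd_E5]; decide
  · rw [corank_E6_even hC, omegaOdd_E6]; decide
  · rw [corank_E7_even hC, omegaOdd_E7]; decide
  · rw [corank_E8_even hC, omegaOdd_E8]; decide


/-! ### The Liouville (`Ω`) variant breaks already at period 4 (granted Cassels) -/

/-- The `Ω`-VARIANT of the crux with exponent `M`: prime factors of `t² + 1` counted WITH multiplicity
(`ArithmeticFunction.cardFactors`; the factor `2^{v₂}` has `v₂ ∈ {0, 1}` determined by the parity of `t`,
so including it is cosmetic). This is the dictionary one would need for `λ(t²+1)` instead of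
`(-1)^{ω(t²+1)}` / `μ`. -/
def LiouvilleVariantWith (M : ℕ) : Prop :=
  ∃ w : ℕ → ℤ, (∀ t : ℕ, w (t + 2 ^ M) = w t) ∧ ∀ t : ℕ, 1 ≤ t →
    (-1 : ℤ) ^ (WeierstrassCurve.selmerCorank (⟨0, 2 * (t : ℚ), 0, (t : ℚ) ^ 2 + 1, 0⟩ :
      WeierstrassCurve ℚ) 2) =
      -(w t * (-1 : ℤ) ^ (ArithmeticFunction.cardFactors (t ^ 2 + 1)))

theorem cardFactors_ten : ArithmeticFunction.cardFactors (3 ^ 2 + 1) = 2 := by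
  rw [show (3 : ℕ) ^ 2 + 1 = 2 * 5 by norm_num, ArithmeticFunction.cardFactors_mul (by norm_num) (by norm_num),
    ArithmeticFunction.cardFactors_apply_prime Nat.prime_two,
    ArithmeticFunction.cardFactors_apply_prime Nat.prime_five]

theorem cardFactors_fifty : ArithmeticFunction.cardFactors (7 ^ 2 + 1) = 3 := by
  rw [show (7 : ℕ) ^ 2 + 1 = 2 * 5 ^ 2 by norm_num,
    ArithmeticFunction.cardFactors_mul (by norm_num) (by norm_num),
    ArithmeticFunction.cardFactors_apply_prime Nat.prime_two,
    ArithmeticFunction.cardFactors_apply_prime_pow Nat.prime_five]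

/-- **The `Ω`/Liouville variant is FALSE with period `4`** (granted Cassels' formula): at `t = 3`
(`10 = 2·5`, `Ω = 2`) and `t = 7` (`50 = 2·5²`, `Ω = 3`) the Selmer parities are both even
(`corank_E3_even`, `corank_E7_even`), so the `Ω`-signs differ while `7 ≡ 3 (mod 4)`. Contrast: the crux
(`ω`-currency) is consistent with period `4` on `t ≤ 8` (`sharp_table_holds_upto_eight`). The square
factor `5² ∣ 7² + 1` is what separates `λ` from `μ·(−1)^ω`; the route's junction `OmegaToMobiusAP`
(squarefree sieve) is therefore not optional. -/
theorem not_liouvilleVariantWith_two (hC : cassels_selmerCorank_two_parity) :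
    ¬ LiouvilleVariantWith 2 := by
  rintro ⟨w, hw, h⟩
  have h3 := h 3 (by norm_num)
  have h7 := h 7 (by norm_num)
  rw [corank_E3_even hC, cardFactors_ten] at h3
  rw [corank_E7_even hC, cardFactors_fifty] at h7
  have hw7 : w 7 = w 3 := by
    have := hw 3
    norm_num at this
    exact this
  rw [hw7] at h7
  have e2 : ((-1 : ℤ)) ^ 2 = 1 := by norm_num
  have e3 : ((-1 : ℤ)) ^ 3 = -1 := by norm_num
  rw [e2] at h3
  rw [e3] at h7
  omega

/-- A `P`-periodic function is `P·k`-periodic. [folklore] -/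
theorem periodic_mul {w : ℕ → ℤ} {P : ℕ} (hw : ∀ t : ℕ, w (t + P) = w t) (k : ℕ) :
    ∀ t : ℕ, w (t + P * k) = w t := by
  induction k with
  | zero => intro t; simp
  | succ k ih => intro t; rw [Nat.mul_succ, ← add_assoc, hw, ih]

/-- Hence the `Ω`-variant is false for every `M ≤ 2`. -/
theorem not_liouvilleVariantWith_of_le_two (hC : cassels_selmerCorank_two_parity) {M : ℕ} (hM : M ≤ 2) :
    ¬ LiouvilleVariantWith M := by
  rintro ⟨w, hw, h⟩
  refine not_liouvilleVariantWith_two hC ⟨w, fun t => ?_, h⟩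
  obtain ⟨k, hk⟩ : ∃ k, 2 ^ 2 = 2 ^ M * k := by
    interval_cases M
    · exact ⟨4, by norm_num⟩
    · exact ⟨2, by norm_num⟩
    · exact ⟨1, by norm_num⟩
  rw [hk]
  exact periodic_mul hw k t


/-! ### A third period: `t = 9, 10, 11, 12` -/

theorem squarefree_41 : Squarefree (41 : ℤ) := squarefree_int_of_forall (by norm_num) (by decide)
theorem squarefree_82 : Squarefree (82 : ℤ) := squarefree_int_of_forall (by norm_num) (by decide)
theorem squarefree_101 : Squarefree (101 : ℤ) := squarefree_int_of_forall (by norm_num) (by decide)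
theorem squarefree_122 : Squarefree (122 : ℤ) := squarefree_int_of_forall (by norm_num) (by decide)
theorem squarefree_145 : Squarefree (145 : ℤ) := squarefree_int_of_forall (by norm_num) (by decide)

theorem eq_of_dvd_82 {d : ℤ} (hdvd : d ∣ 82) :
    d = 1 ∨ d = -1 ∨ d = 2 ∨ d = -2 ∨ d = 41 ∨ d = -41 ∨ d = 82 ∨ d = -82 := by
  have hn : d.natAbs ∣ 82 := by
    have := Int.natAbs_dvd_natAbs.mpr hdvd
    simpa using this
  have hmem : d.natAbs ∈ Nat.divisors 82 := Nat.mem_divisors.mpr ⟨hn, by norm_num⟩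
  have : Nat.divisors 82 = {1, 2, 41, 82} := by decide
  rw [this] at hmem
  simp only [Finset.mem_insert, Finset.mem_singleton] at hmem
  omega

theorem eq_of_dvd_122 {d : ℤ} (hdvd : d ∣ 122) :
    d = 1 ∨ d = -1 ∨ d = 2 ∨ d = -2 ∨ d = 61 ∨ d = -61 ∨ d = 122 ∨ d = -122 := by
  have hn : d.natAbs ∣ 122 := by
    have := Int.natAbs_dvd_natAbs.mpr hdvd
    simpa using this
  have hmem : d.natAbs ∈ Nat.divisors 122 := Nat.mem_divisors.mpr ⟨hn, by norm_num⟩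
  have : Nat.divisors 122 = {1, 2, 61, 122} := by decide
  rw [this] at hmem
  simp only [Finset.mem_insert, Finset.mem_singleton] at hmem
  omega

theorem eq_of_dvd_145 {d : ℤ} (hdvd : d ∣ 145) :
    d = 1 ∨ d = -1 ∨ d = 5 ∨ d = -5 ∨ d = 29 ∨ d = -29 ∨ d = 145 ∨ d = -145 := by
  have hn : d.natAbs ∣ 145 := by
    have := Int.natAbs_dvd_natAbs.mpr hdvd
    simpa using this
  have hmem : d.natAbs ∈ Nat.divisors 145 := Nat.mem_divisors.mpr ⟨hn, by norm_num⟩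
  have : Nat.divisors 145 = {1, 5, 29, 145} := by decide
  rw [this] at hmem
  simp only [Finset.mem_insert, Finset.mem_singleton] at hmem
  omega

theorem not_isSoluble_two_E9_d2 :
    ¬ ((twoIsogenyQuartic (-36) 2 (-2)).map (Int.castRingHom ℚ_[2])).IsSoluble := by
  apply not_isSoluble_padic_of_zmod 2 5 <;> decide
theorem not_isSoluble_two_E9_dneg2 :
    ¬ ((twoIsogenyQuartic (-36) (-2) 2).map (Int.castRingHom ℚ_[2])).IsSoluble := by
  apply not_isSoluble_padic_of_zmod 2 5 <;> decide
theorem not_isSoluble_two_E10_d2 :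
    ¬ ((twoIsogenyQuartic (-40) 2 (-2)).map (Int.castRingHom ℚ_[2])).IsSoluble := by
  apply not_isSoluble_padic_of_zmod 2 4 <;> decide
theorem not_isSoluble_two_E10_dneg2 :
    ¬ ((twoIsogenyQuartic (-40) (-2) 2).map (Int.castRingHom ℚ_[2])).IsSoluble := by
  apply not_isSoluble_padic_of_zmod 2 4 <;> decide
theorem not_isSoluble_two_E11_d2 :
    ¬ ((twoIsogenyQuartic (-44) 2 (-2)).map (Int.castRingHom ℚ_[2])).IsSoluble := by
  apply not_isSoluble_padic_of_zmod 2 5 <;> decide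
theorem not_isSoluble_two_E11_dneg2 :
    ¬ ((twoIsogenyQuartic (-44) (-2) 2).map (Int.castRingHom ℚ_[2])).IsSoluble := by
  apply not_isSoluble_padic_of_zmod 2 5 <;> decide
theorem not_isSoluble_five_E12_d2 :
    ¬ ((twoIsogenyQuartic (-48) 2 (-2)).map (Int.castRingHom ℚ_[5])).IsSoluble := by
  apply not_isSoluble_padic_of_zmod 5 1 <;> decide
theorem not_isSoluble_five_E12_dneg2 :
    ¬ ((twoIsogenyQuartic (-48) (-2) 2).map (Int.castRingHom ℚ_[5])).IsSoluble := by
  apply not_isSoluble_padic_of_zmod 5 1 <;> decide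
theorem not_isSoluble_two_E11_b_d2 :
    ¬ ((twoIsogenyQuartic 22 2 61).map (Int.castRingHom ℚ_[2])).IsSoluble := by
  apply not_isSoluble_padic_of_zmod 2 4 <;> decide
theorem not_isSoluble_two_E11_b_d61 :
    ¬ ((twoIsogenyQuartic 22 61 2).map (Int.castRingHom ℚ_[2])).IsSoluble := by
  apply not_isSoluble_padic_of_zmod 2 4 <;> decide
theorem not_isSoluble_two_E12_b_d5 :
    ¬ ((twoIsogenyQuartic 24 5 29).map (Int.castRingHom ℚ_[2])).IsSoluble := by
  apply not_isSoluble_padic_of_zmod 2 4 <;> decide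
theorem not_isSoluble_two_E12_b_d29 :
    ¬ ((twoIsogenyQuartic 24 29 5).map (Int.castRingHom ℚ_[2])).IsSoluble := by
  apply not_isSoluble_padic_of_zmod 2 4 <;> decide

/-- `S(18, 82) = {1, 2, 41, 82}` (`E_9`; `2, 41` GLOBAL: `29² = 2·4⁴ + 18·4² + 41`, the point `(32, 232)`
of infinite order on `E_9 : y² = x³ + 18x² + 82x`). -/
theorem selmer_E9 : twoIsogenySelmerGroup 18 82 = {1, 2, 41, 82} := by
  ext d
  rw [mem_twoIsogenySelmerGroup_iff (by norm_num)]
  constructor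
  · rintro ⟨hsf, hdvd, hloc⟩
    rcases eq_of_dvd_82 hdvd with rfl | rfl | rfl | rfl | rfl | rfl | rfl | rfl
    · simp
    · exact absurd hloc.1 (not_isSoluble_real_of_negDef (by norm_num) (by norm_num))
    · simp
    · exact absurd hloc.1 (not_isSoluble_real_of_negDef (by norm_num) (by norm_num))
    · simp
    · exact absurd hloc.1 (not_isSoluble_real_of_negDef (by norm_num) (by norm_num))
    · simp
    · exact absurd hloc.1 (not_isSoluble_real_of_negDef (by norm_num) (by norm_num))
  · intro hd
    simp only [Finset.mem_insert, Finset.mem_singleton] at hd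
    rcases hd with rfl | rfl | rfl | rfl
    · exact (mem_twoIsogenySelmerGroup_iff (by norm_num)).mp (one_mem_twoIsogenySelmerGroup 18 (by norm_num))
    · refine ⟨squarefree_two, by norm_num, ?_⟩
      exact isLocallySoluble_of_int_point _ (x := 4) (y := 1) (z := 29) (Or.inl (by norm_num))
        (by norm_num [twoIsogenyQuartic, BinaryQuartic.eval])
    · refine ⟨squarefree_41, by norm_num, ?_⟩
      exact isLocallySoluble_of_int_point _ (x := 1) (y := 4) (z := 29) (Or.inl (by norm_num))
        (by norm_num [twoIsogenyQuartic, BinaryQuartic.eval])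
    · exact (mem_twoIsogenySelmerGroup_iff (by norm_num)).mp
        (self_mem_twoIsogenySelmerGroup 18 squarefree_82)

theorem selmer'_E9 : twoIsogenySelmerGroup (-36) (-4) = {1, -1} := by
  ext d
  rw [mem_twoIsogenySelmerGroup_iff (by norm_num)]
  constructor
  · rintro ⟨hsf, hdvd, hloc⟩
    rcases eq_of_squarefree_dvd_neg_four hsf hdvd with rfl | rfl | rfl | rfl
    · simp
    · simp
    · exact absurd (hloc.2 2) (by simpa using not_isSoluble_two_E9_d2)
    · exact absurd (hloc.2 2) (by simpa using not_isSoluble_two_E9_dneg2)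
  · intro hd
    simp only [Finset.mem_insert, Finset.mem_singleton] at hd
    rcases hd with rfl | rfl
    · exact (mem_twoIsogenySelmerGroup_iff (by norm_num)).mp
        (one_mem_twoIsogenySelmerGroup (-36) (by norm_num))
    · exact (mem_twoIsogenySelmerGroup_iff (by norm_num)).mp
        (mem_twoIsogenySelmerGroup_of_isSquare (by norm_num) squarefree_neg_one (by norm_num)
          ⟨2, by norm_num⟩)

theorem selmer_E10 : twoIsogenySelmerGroup 20 101 = {1, 101} := by
  ext d
  rw [mem_twoIsogenySelmerGroup_iff (by norm_num)]
  constructor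
  · rintro ⟨hsf, hdvd, hloc⟩
    rcases eq_of_dvd_prime (by norm_num : Nat.Prime 101) (by exact_mod_cast hdvd) with
      rfl | rfl | rfl | rfl
    · simp
    · exact absurd hloc.1 (not_isSoluble_real_of_negDef (by norm_num) (by norm_num))
    · simp
    · exact absurd hloc.1 (not_isSoluble_real_of_negDef (by norm_num) (by norm_num))
  · intro hd
    simp only [Finset.mem_insert, Finset.mem_singleton] at hd
    rcases hd with rfl | rfl
    · exact (mem_twoIsogenySelmerGroup_iff (by norm_num)).mp (one_mem_twoIsogenySelmerGroup 20 (by norm_num))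
    · exact (mem_twoIsogenySelmerGroup_iff (by norm_num)).mp
        (self_mem_twoIsogenySelmerGroup 20 squarefree_101)

theorem selmer'_E10 : twoIsogenySelmerGroup (-40) (-4) = {1, -1} := by
  ext d
  rw [mem_twoIsogenySelmerGroup_iff (by norm_num)]
  constructor
  · rintro ⟨hsf, hdvd, hloc⟩
    rcases eq_of_squarefree_dvd_neg_four hsf hdvd with rfl | rfl | rfl | rfl
    · simp
    · simp
    · exact absurd (hloc.2 2) (by simpa using not_isSoluble_two_E10_d2)
    · exact absurd (hloc.2 2) (by simpa using not_isSoluble_two_E10_dneg2)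
  · intro hd
    simp only [Finset.mem_insert, Finset.mem_singleton] at hd
    rcases hd with rfl | rfl
    · exact (mem_twoIsogenySelmerGroup_iff (by norm_num)).mp
        (one_mem_twoIsogenySelmerGroup (-40) (by norm_num))
    · exact (mem_twoIsogenySelmerGroup_iff (by norm_num)).mp
        (mem_twoIsogenySelmerGroup_of_isSquare (by norm_num) squarefree_neg_one (by norm_num)
          ⟨2, by norm_num⟩)

theorem selmer_E11 : twoIsogenySelmerGroup 22 122 = {1, 122} := by
  ext d
  rw [mem_twoIsogenySelmerGroup_iff (by norm_num)]
  constructor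
  · rintro ⟨hsf, hdvd, hloc⟩
    rcases eq_of_dvd_122 hdvd with rfl | rfl | rfl | rfl | rfl | rfl | rfl | rfl
    · simp
    · exact absurd hloc.1 (not_isSoluble_real_of_negDef (by norm_num) (by norm_num))
    · exact absurd (hloc.2 2) (by simpa using not_isSoluble_two_E11_b_d2)
    · exact absurd hloc.1 (not_isSoluble_real_of_negDef (by norm_num) (by norm_num))
    · exact absurd (hloc.2 2) (by simpa using not_isSoluble_two_E11_b_d61)
    · exact absurd hloc.1 (not_isSoluble_real_of_negDef (by norm_num) (by norm_num))
    · simp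
    · exact absurd hloc.1 (not_isSoluble_real_of_negDef (by norm_num) (by norm_num))
  · intro hd
    simp only [Finset.mem_insert, Finset.mem_singleton] at hd
    rcases hd with rfl | rfl
    · exact (mem_twoIsogenySelmerGroup_iff (by norm_num)).mp (one_mem_twoIsogenySelmerGroup 22 (by norm_num))
    · exact (mem_twoIsogenySelmerGroup_iff (by norm_num)).mp
        (self_mem_twoIsogenySelmerGroup 22 squarefree_122)

theorem selmer'_E11 : twoIsogenySelmerGroup (-44) (-4) = {1, -1} := by
  ext d
  rw [mem_twoIsogenySelmerGroup_iff (by norm_num)]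
  constructor
  · rintro ⟨hsf, hdvd, hloc⟩
    rcases eq_of_squarefree_dvd_neg_four hsf hdvd with rfl | rfl | rfl | rfl
    · simp
    · simp
    · exact absurd (hloc.2 2) (by simpa using not_isSoluble_two_E11_d2)
    · exact absurd (hloc.2 2) (by simpa using not_isSoluble_two_E11_dneg2)
  · intro hd
    simp only [Finset.mem_insert, Finset.mem_singleton] at hd
    rcases hd with rfl | rfl
    · exact (mem_twoIsogenySelmerGroup_iff (by norm_num)).mp
        (one_mem_twoIsogenySelmerGroup (-44) (by norm_num))
    · exact (mem_twoIsogenySelmerGroup_iff (by norm_num)).mp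
        (mem_twoIsogenySelmerGroup_of_isSquare (by norm_num) squarefree_neg_one (by norm_num)
          ⟨2, by norm_num⟩)

theorem selmer_E12 : twoIsogenySelmerGroup 24 145 = {1, 145} := by
  ext d
  rw [mem_twoIsogenySelmerGroup_iff (by norm_num)]
  constructor
  · rintro ⟨hsf, hdvd, hloc⟩
    rcases eq_of_dvd_145 hdvd with rfl | rfl | rfl | rfl | rfl | rfl | rfl | rfl
    · simp
    · exact absurd hloc.1 (not_isSoluble_real_of_negDef (by norm_num) (by norm_num))
    · exact absurd (hloc.2 2) (by simpa using not_isSoluble_two_E12_b_d5)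
    · exact absurd hloc.1 (not_isSoluble_real_of_negDef (by norm_num) (by norm_num))
    · exact absurd (hloc.2 2) (by simpa using not_isSoluble_two_E12_b_d29)
    · exact absurd hloc.1 (not_isSoluble_real_of_negDef (by norm_num) (by norm_num))
    · simp
    · exact absurd hloc.1 (not_isSoluble_real_of_negDef (by norm_num) (by norm_num))
  · intro hd
    simp only [Finset.mem_insert, Finset.mem_singleton] at hd
    rcases hd with rfl | rfl
    · exact (mem_twoIsogenySelmerGroup_iff (by norm_num)).mp (one_mem_twoIsogenySelmerGroup 24 (by norm_num))
    · exact (mem_twoIsogenySelmerGroup_iff (by norm_num)).mp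
        (self_mem_twoIsogenySelmerGroup 24 squarefree_145)

theorem selmer'_E12 : twoIsogenySelmerGroup (-48) (-4) = {1, -1} := by
  ext d
  rw [mem_twoIsogenySelmerGroup_iff (by norm_num)]
  constructor
  · rintro ⟨hsf, hdvd, hloc⟩
    rcases eq_of_squarefree_dvd_neg_four hsf hdvd with rfl | rfl | rfl | rfl
    · simp
    · simp
    · exact absurd (hloc.2 5) (by simpa using not_isSoluble_five_E12_d2)
    · exact absurd (hloc.2 5) (by simpa using not_isSoluble_five_E12_dneg2)
  · intro hd
    simp only [Finset.mem_insert, Finset.mem_singleton] at hd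
    rcases hd with rfl | rfl
    · exact (mem_twoIsogenySelmerGroup_iff (by norm_num)).mp
        (one_mem_twoIsogenySelmerGroup (-48) (by norm_num))
    · exact (mem_twoIsogenySelmerGroup_iff (by norm_num)).mp
        (mem_twoIsogenySelmerGroup_of_isSquare (by norm_num) squarefree_neg_one (by norm_num)
          ⟨2, by norm_num⟩)

theorem rank_E9 : twoIsogenySelmerRank 18 82 = 2 := by
  rw [twoIsogenySelmerRank, selmer_E9]; decide
theorem rank'_E9 : twoIsogenySelmerRank' 18 82 = 1 := by
  rw [twoIsogenySelmerRank', show (-2 * 18 : ℤ) = -36 by norm_num,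
    show ((18 : ℤ) ^ 2 - 4 * 82) = -4 by norm_num, twoIsogenySelmerRank, selmer'_E9]; decide
theorem rank_E10 : twoIsogenySelmerRank 20 101 = 1 := by
  rw [twoIsogenySelmerRank, selmer_E10]; decide
theorem rank'_E10 : twoIsogenySelmerRank' 20 101 = 1 := by
  rw [twoIsogenySelmerRank', show (-2 * 20 : ℤ) = -40 by norm_num,
    show ((20 : ℤ) ^ 2 - 4 * 101) = -4 by norm_num, twoIsogenySelmerRank, selmer'_E10]; decide
theorem rank_E11 : twoIsogenySelmerRank 22 122 = 1 := by
  rw [twoIsogenySelmerRank, selmer_E11]; decide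
theorem rank'_E11 : twoIsogenySelmerRank' 22 122 = 1 := by
  rw [twoIsogenySelmerRank', show (-2 * 22 : ℤ) = -44 by norm_num,
    show ((22 : ℤ) ^ 2 - 4 * 122) = -4 by norm_num, twoIsogenySelmerRank, selmer'_E11]; decide
theorem rank_E12 : twoIsogenySelmerRank 24 145 = 1 := by
  rw [twoIsogenySelmerRank, selmer_E12]; decide
theorem rank'_E12 : twoIsogenySelmerRank' 24 145 = 1 := by
  rw [twoIsogenySelmerRank', show (-2 * 24 : ℤ) = -48 by norm_num,
    show ((24 : ℤ) ^ 2 - 4 * 145) = -4 by norm_num, twoIsogenySelmerRank, selmer'_E12]; decide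

theorem corank_E9_odd (hC : cassels_selmerCorank_two_parity) :
    (-1 : ℤ) ^ (WeierstrassCurve.selmerCorank
      (⟨0, 2 * ((9 : ℕ) : ℚ), 0, ((9 : ℕ) : ℚ) ^ 2 + 1, 0⟩ : WeierstrassCurve ℚ) 2) = -1 := by
  have h := hC 18 82 (by norm_num)
  rw [rank_E9, rank'_E9] at h
  have e : (⟨0, 2 * ((9 : ℕ) : ℚ), 0, ((9 : ℕ) : ℚ) ^ 2 + 1, 0⟩ : WeierstrassCurve ℚ) =
      ⟨0, ((18 : ℤ) : ℚ), 0, ((82 : ℤ) : ℚ), 0⟩ := by norm_num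
  rw [e, h]; norm_num
theorem corank_E10_even (hC : cassels_selmerCorank_two_parity) :
    (-1 : ℤ) ^ (WeierstrassCurve.selmerCorank
      (⟨0, 2 * ((10 : ℕ) : ℚ), 0, ((10 : ℕ) : ℚ) ^ 2 + 1, 0⟩ : WeierstrassCurve ℚ) 2) = 1 := by
  have h := hC 20 101 (by norm_num)
  rw [rank_E10, rank'_E10] at h
  have e : (⟨0, 2 * ((10 : ℕ) : ℚ), 0, ((10 : ℕ) : ℚ) ^ 2 + 1, 0⟩ : WeierstrassCurve ℚ) =
      ⟨0, ((20 : ℤ) : ℚ), 0, ((101 : ℤ) : ℚ), 0⟩ := by norm_num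
  rw [e, h]; norm_num
theorem corank_E11_even (hC : cassels_selmerCorank_two_parity) :
    (-1 : ℤ) ^ (WeierstrassCurve.selmerCorank
      (⟨0, 2 * ((11 : ℕ) : ℚ), 0, ((11 : ℕ) : ℚ) ^ 2 + 1, 0⟩ : WeierstrassCurve ℚ) 2) = 1 := by
  have h := hC 22 122 (by norm_num)
  rw [rank_E11, rank'_E11] at h
  have e : (⟨0, 2 * ((11 : ℕ) : ℚ), 0, ((11 : ℕ) : ℚ) ^ 2 + 1, 0⟩ : WeierstrassCurve ℚ) =
      ⟨0, ((22 : ℤ) : ℚ), 0, ((122 : ℤ) : ℚ), 0⟩ := by norm_num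
  rw [e, h]; norm_num
theorem corank_E12_even (hC : cassels_selmerCorank_two_parity) :
    (-1 : ℤ) ^ (WeierstrassCurve.selmerCorank
      (⟨0, 2 * ((12 : ℕ) : ℚ), 0, ((12 : ℕ) : ℚ) ^ 2 + 1, 0⟩ : WeierstrassCurve ℚ) 2) = 1 := by
  have h := hC 24 145 (by norm_num)
  rw [rank_E12, rank'_E12] at h
  have e : (⟨0, 2 * ((12 : ℕ) : ℚ), 0, ((12 : ℕ) : ℚ) ^ 2 + 1, 0⟩ : WeierstrassCurve ℚ) =
      ⟨0, ((24 : ℤ) : ℚ), 0, ((145 : ℤ) : ℚ), 0⟩ := by norm_num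
  rw [e, h]; norm_num

theorem omegaOdd_E9 : (((9 : ℕ) ^ 2 + 1).primeFactors.filter (fun p : ℕ => p ≠ 2)).card = 1 := by
  rw [show (9 : ℕ) ^ 2 + 1 = 2 * 41 by norm_num, Nat.primeFactors_mul (by norm_num) (by norm_num),
    Nat.Prime.primeFactors Nat.prime_two, Nat.Prime.primeFactors (by norm_num : Nat.Prime 41)]; decide
theorem omegaOdd_E10 : (((10 : ℕ) ^ 2 + 1).primeFactors.filter (fun p : ℕ => p ≠ 2)).card = 1 := by
  rw [show (10 : ℕ) ^ 2 + 1 = 101 by norm_num, Nat.Prime.primeFactors (by norm_num : Nat.Prime 101)]; decide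
theorem omegaOdd_E11 : (((11 : ℕ) ^ 2 + 1).primeFactors.filter (fun p : ℕ => p ≠ 2)).card = 1 := by
  rw [show (11 : ℕ) ^ 2 + 1 = 2 * 61 by norm_num, Nat.primeFactors_mul (by norm_num) (by norm_num),
    Nat.Prime.primeFactors Nat.prime_two, Nat.Prime.primeFactors (by norm_num : Nat.Prime 61)]; decide
theorem omegaOdd_E12 : (((12 : ℕ) ^ 2 + 1).primeFactors.filter (fun p : ℕ => p ≠ 2)).card = 2 := by
  rw [show (12 : ℕ) ^ 2 + 1 = 5 * 29 by norm_num, Nat.primeFactors_mul (by norm_num) (by norm_num),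
    Nat.Prime.primeFactors Nat.prime_five, Nat.Prime.primeFactors (by norm_num : Nat.Prime 29)]; decide

/-- THREE full periods: granted Cassels' formula, any witness of the crux has
`w(1..12) = (-1, 1, 1, -1, -1, 1, 1, -1, -1, 1, 1, -1)`. -/
theorem forced_w_values_upto_twelve (hC : cassels_selmerCorank_two_parity) {w : ℕ → ℤ}
    (h : ∀ t : ℕ, 1 ≤ t →
      (-1 : ℤ) ^ (WeierstrassCurve.selmerCorank (⟨0, 2 * (t : ℚ), 0, (t : ℚ) ^ 2 + 1, 0⟩ :
        WeierstrassCurve ℚ) 2) =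
        -(w t * (-1 : ℤ) ^ (((t ^ 2 + 1).primeFactors.filter (fun p : ℕ => p ≠ 2)).card))) :
    (w 1 = -1 ∧ w 2 = 1 ∧ w 3 = 1 ∧ w 4 = -1 ∧ w 5 = -1 ∧ w 6 = 1 ∧ w 7 = 1 ∧ w 8 = -1) ∧
      (w 9 = -1 ∧ w 10 = 1 ∧ w 11 = 1 ∧ w 12 = -1) := by
  refine ⟨forced_w_values_upto_eight hC h, ?_⟩
  have h9 := h 9 (by norm_num)
  have h10 := h 10 (by norm_num)
  have h11 := h 11 (by norm_num)
  have h12 := h 12 (by norm_num)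
  rw [corank_E9_odd hC, omegaOdd_E9] at h9
  rw [corank_E10_even hC, omegaOdd_E10] at h10
  rw [corank_E11_even hC, omegaOdd_E11] at h11
  rw [corank_E12_even hC, omegaOdd_E12] at h12
  simp only [pow_one, mul_neg, mul_one, neg_neg] at h9 h10 h11 h12
  have h12' : w 12 = -1 := by
    have : ((-1 : ℤ)) ^ 2 = 1 := by norm_num
    rw [this, mul_one] at h12
    linarith
  omega

/-- The sharp table holds on `1 ≤ t ≤ 12`, granted Cassels' formula. -/
theorem sharp_table_holds_upto_twelve (hC : cassels_selmerCorank_two_parity) (t : ℕ) (ht : 1 ≤ t)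
    (ht12 : t ≤ 12) :
    (-1 : ℤ) ^ (WeierstrassCurve.selmerCorank (⟨0, 2 * (t : ℚ), 0, (t : ℚ) ^ 2 + 1, 0⟩ :
        WeierstrassCurve ℚ) 2) =
      -(wTable (t % 2 ^ 2) * (-1 : ℤ) ^ (((t ^ 2 + 1).primeFactors.filter (fun p : ℕ => p ≠ 2)).card)) := by
  rcases Nat.lt_or_ge t 9 with hlt | hge
  · exact sharp_table_holds_upto_eight hC t ht (by omega)
  interval_cases t
  · rw [corank_E9_odd hC, omegaOdd_E9]; decide
  · rw [corank_E10_even hC, omegaOdd_E10]; decide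
  · rw [corank_E11_even hC, omegaOdd_E11]; decide
  · rw [corank_E12_even hC, omegaOdd_E12]; decide


/-- PACKAGING FOR THE PROVER: the conjectured sharp dictionary (period `4`, table `wTable`) closes the crux
(`of_sharp` of §4 at `M = 2`): it suffices to prove `∀ t ≥ 1, (-1)^{corank(E_t)} = -(wTable (t % 4)·(-1)^{ω_odd})`,
i.e. `corank Sel_{2^∞}(E_t) ≡ ⌊t/2⌋ + ω_odd(t²+1) (mod 2)`. [folklore] -/
theorem crux_of_sharp_table
    (h : ∀ t : ℕ, 1 ≤ t →
      (-1 : ℤ) ^ (WeierstrassCurve.selmerCorank (⟨0, 2 * (t : ℚ), 0, (t : ℚ) ^ 2 + 1, 0⟩ :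
        WeierstrassCurve ℚ) 2) =
        -(wTable (t % 2 ^ 2) * (-1 : ℤ) ^ (((t ^ 2 + 1).primeFactors.filter (fun p : ℕ => p ≠ 2)).card))) :
    Summit.Parity.BatemanHorn.Theses.IsogenyRedei.PencilSelmerDictionary :=
  of_sharp 2 wTable h

end Descent

/-! ## §5 Numerical attacks (PARI) — STATUS: queued on the saturated farm

Jobs (both `--workitem stmt-Parity-11584`, summaries auto-attach to the item; scripts `jobs/w2table.gp`,
`jobs/w2small.gp` in the seat folder):
* `j004779` (t ≤ 20000; global check t ≤ 3000) and `j005247` (t ≤ 3000; global check t ≤ 300):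
  (i) `w(t) := ellrootno(E_t, 2)`; least `M ≤ 16` with `w` a function of `t mod 2^M`; the table;
  (ii) `ellrootno(E_t) == -w(t)·(-1)^{#odd p ∣ t²+1}` and `ellrootno(E_t, p) = -1`, `elllocalred`
  multiplicative, at every odd `p ∣ t²+1`; conductor `= 2^{f₂} · rad_odd(t²+1)`;
  (iii) corner rows `w(2^k)`, `w(3·2^k)`, `w(5·2^k)` (2-adic convergence `t → 0`);
  (iv) Kodaira symbol / `(v₂(c₄), v₂(c₆), v₂(Δ))` at 2 for `t ≤ 64` (expected: III, f₂ = 7 for odd `t`;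
  II, f₂ = 6 for even `t` — §2b);
  (v) CONTROL: the sister pencil `[0, 2t, 0, t²-1, 0]`, same periodicity test, expected to report NO
  period `≤ 2^16` (rows `w(1+2^k)` not stabilising).
* Earlier seats queued ≥ 15 equivalent jobs (j003439 … j003614, prio 75) on 2026-08-15 18:30–19:10Z;
  none had reported by 22:40Z (farm backlog: 1895 queued, p95 wait 3.7 h, cdisprove prio 79).
* INDEPENDENT SELMER-SIDE NUMERICS EXIST: the crux ideator's job j004946 (card `cassels-local-images-mod4`,
  evidence on the item 22:34Z) reports period 4 with `w = (-1, -1, +1, +1)` on `t mod 4` for `t ≤ 4000`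
  via Cassels' formula and explicit descent counts — no root numbers involved; §4b certifies the same
  table on `t ≤ 4` in Lean. The PARI jobs here will add the ROOT-NUMBER side (`W₂(E_t)`), i.e. an
  independent check through 2-parity, plus the split-fibre and sister-pencil controls.

PREDICTIONS to be checked (hand analysis): (a) a least period exists (theorem: §6); (b) `w(t) = -1`
for `t ≡ 0 (mod 8)`: Helfgott's Prop. 4.2 proof gives the explicit radius `|𝐚_j - a_j| < |u|^7` around
`E_0 : y² = x³ + x` with `v_L(u) = e/2` (`v₂(Δ(E_0)) = 6`), i.e. `v₂(2t) ≥ 4`, `v₂(t²) ≥ 4`, so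
`W₂(E_t) = W₂(E_0) = W(E_0)/W_∞ = (+1)/(-1) = -1` for `v₂(t) ≥ 3` (`E_0` has analytic rank 0); in crux
currency: `corank Sel_{2^∞}(E_t) ≡ ω(t²+1) (mod 2)` for `8 ∣ t`. (c) NATURAL STRENGTHENINGS expected to
die numerically: `M = 0` (w constant) as soon as both signs occur; the Liouville variant
`(-1)^corank = -w(t)(-1)^{Ω_odd(t²+1)}` (differs from the crux by `(-1)^{Σ(v_p - 1)}`, not periodic:
`t = 7`, `50 = 2·5²`). None of (a)–(c) is decidable in Lean (`selmerCorank` is not evaluable).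

## §6 Why the crux resists (and cannot be refuted in Lean at all)

`¬ PencilSelmerDictionary` would require the parities of `corank Sel_{2^∞}(E_t/ℚ)` for infinitely many
`t`, and `WeierstrassCurve.selmerCorank` (Literature `Selmer.lean`: `zpCorank` of the continuous-cohomology
Selmer group) is a genuine, non-computable definition — no junk route (it is not a placeholder `Prop`,
and nothing about its values is provable today). On paper the crux is a THEOREM:
(1) `(-1)^{corank} = W(E_t)` — 2-parity over `ℚ` (Dokchitser–Dokchitser, Ann. Math. 172 (2010) Thm 1.4;
Monsky 1996), tree fact `Literature.NumberTheory.EllipticCurves.p_parity`;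
(2) `W = W_∞ ∏_p W_p`, `W_∞ = -1` (tree: clause (4) of `exists_local_tables_two_three` /
`Helfgott2004_exists_local_tables_locallyConstant`);
(3) odd `p ∣ t²+1`: `v_p(c₄) = v_p(16(t²-3)) = 0` (`t² - 3 ≡ -4`), minimal, multiplicative, reduction
`y² = x²(x + 2t)`, tangent slopes `±√(2t)`, `(2t|p) = (2|p)(t|p) = +1` because `p ≡ 1 (4)` and `t` has
order 4 (`(t|p) = +1 ⟺ p ≡ 1 (8) ⟺ (2|p) = +1`) ⇒ SPLIT ⇒ `W_p = -1` (Rohrlich 1993 Prop. 2; tree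
`localRootNumberAt_of_hasSplitMultiplicativeReductionAt`); odd `p ∤ t²+1` (incl. `p = 3` always): good,
`W_p = +1`; hence `s(t) = (-1)^{corank+ω_odd} = -W₂(E_t)·[w₃-table value]`;
(4) `t ↦ W₂(E_t)` is locally constant on `ℤ₂` (Helfgott 2004 Lemma 4.4, p. 11, at every `t₀ ∈ ℤ₂`: the
place `T - t₀` is a place of good reduction of the pencil since `Δ = -64(T²+1)²` has no zero in `ℤ₂`;
§2b) hence, `ℤ₂` being compact, a function of `t mod 2^M` (tree: `exists_forall_sub_mem_pow_imp_eq_of_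
locallyConstant` + `polyCurve_Δ_ne_zero_of_forall_not_mem_pow`, hypothesis = §2b).
Formalisation caveats for the lead (not falsity): the `w₃` pinning gap of §3/§3b, and `PencilSplitFibres`
(stmt-Parity-11587) over `ℚ_p` in Mathlib's reduction vocabulary. -/

end Summit.Parity.BatemanHorn.Cruxes.PencilSelmerDictionary.Disproof
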